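import Literature.MathematicalPhysics.QuantumFieldTheory.Balaban1983to89.B16RLeafRecord13Live
import Literature.MathematicalPhysics.QuantumFieldTheory.Balaban1983to89.Node00.Record13LiveSelectorFamily
import Literature.MathematicalPhysics.QuantumFieldTheory.Balaban1983to89.Node00.Record13BgRow

/-!
# `Balaban1983to89.B16RLeafRecord13AtLive` — YM-DAG nodes N13∕N11 AT NODE 00's STAGE-13 LIVE RE-PIN `θ.liveRepin₁₃` AND AT THE STAGE-13 WITNESSES
# `theta13LiveOfFamily` ∕ `theta13LiveOfRecord` (node00-def-K0a FILE 8): the selector clause of `…B16RLeafRecord13Live` §6 discharged by `rfl`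
# ([Balaban1988Convergent] p. 244, Thm 1 p. 262; [Balaban1989LargeFieldI] (0.3)–(0.4) p. 176, (i)–(ii) p. 177; [Balaban1989LargeFieldII] Thm 1 p. 355)

statement-level bookkeeping over published theorems with citation tags; kernel-checked compositions of tree theorems;
nothing here is a claim about the Yang–Mills mass gap.

Cell `pub-ymgap` (HUMAN RULING D-0062, Track A), seat `pub-ymgap-dag-n11-e` (R134 fan-out row N11∕s3), generation 5 — the ten-line sequel announced in
`…B16RLeafRecord13Live`'s header: node00-def-K0a's `Node00/Record13LiveSelector.lean` (p488983: `Stage13Params.liveRepin₁₃`, `theta13OfFamily`,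
`theta13LiveOfFamily`, `theta13LiveOfRecord`, and the one-row reduction `provisos₁₃_theta13LiveOfRecord_of_bg`) and `Node00/Record13LiveSelectorFamily.lean`
(FILE 9: the open-letter family `theta13LiveOfFamily₂ ε₀ ε₂₉` and the numerics-generic witness `theta13LiveOfNumerics n ε₂₉` with its socket
`provisos₁₃_theta13LiveOfNumerics_of_bg`) LANDED.
[III] = [Balaban1988Convergent], [IV] = [Balaban1989LargeFieldI], [B16] = [Balaban1989LargeFieldII].

WHAT THIS FILE IS.  `…B16RLeafRecord13Live` §6 states the live line through node00-def-T's selector clause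
`hsel : θ.ppSel = ppSelLiveOfRecord F N θ.ν θ.τ9 (EOfRecord₁₃ F N θ) (wOfRecord₉ F N θ.toStage9Params)`; at K0a's re-pin `θ.liveRepin₁₃ F N` that clause is `rfl`
(`liveRepin₁₃_liveSel` — K0a's `liveRepin₁₃_ppSel` read through the selector-blind `rfl` views `EOfRecord₁₃_liveRepin₁₃`, `wOfRecord₉_liveRepin₁₃`), so every §6
theorem is read AT THE RE-PIN with no selector hypothesis (§1), at K0a's family witness `theta13LiveOfFamily F N ε₀ ζ Rz Zt` with admissibility and the three
term-constant signs DISCHARGED by the family's numerals (`κ = 2·10⁴`, `E₀ = B₀ = 1`; §2), and at the witness of record `theta13LiveOfRecord F N` (§3), where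
K0a's `provisos₁₃_theta13LiveOfRecord_of_bg` lets every face be read FROM ROW P11 `bg` ALONE (the `BgProvisoΛ` text at the witness; seat node00-def-P11's
analysis) — in particular ★ `rOpLeaf_VOfRecord₁₃_theta13LiveOfRecord_of_bg`: ON THE K0″ WITNESS LINE N13's 𝐑-LEAF COSTS EXACTLY ROW P11, and
★ `thm1Printed_datumOfRecord₁₃_theta13LiveOfRecord_of_bg_of_laws`: the (B)-face's first conjunct there costs ROW P11 + (S1ᵀ); §4 the same faces at the
open-letter family `theta13LiveOfFamily₂ ε₀ ε₂₉` (`0 < ε₀`, `0 < ε₂₉`); §5 at the NUMERICS-GENERIC witness `theta13LiveOfNumerics n ε₂₉` — where dag-lead WORDS-131 ∕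
ref-D ⚑ EPS-PIN direct every small-row consumer — with `n.Pos`, `0 < ε₂₉` and the three term-constant signs of `n` displayed, and ★ `rOpLeaf_VOfRecord₁₃_theta13LiveOfNumerics_of_bg`:
N13's 𝐑-leaf at `θ₁₃(n)` ⟸ ROW P11 there alone (K0a's socket `provisos₁₃_theta13LiveOfNumerics_of_bg`).

HONEST LABEL.  At a live re-pin 𝐑 of record is the identity up to null sets (`densOfRecord₁₃_succ_ae_eq_tdens_liveRepin₁₃`): N13's printed content is NOT
exercised on this line; Theorem 1 ∕ N11 ∕ the (B)-face conjunct rest on N11's (S1ᵀ) at the live sequences alone.  (S1ᵀ) (Sects. 1–3 of [III]) and row P11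
([III] (2.7) + [15] Thm 1) are DISPLAYED hypotheses; nothing of Bałaban's analysis is asserted; K0″–K3″ NOT discharged; counts unmoved; general `N`; one finite
`𝕋⁴_{L^K}` programme at fixed `ε = L^{−K}` — NOT a continuum ∕ OS ∕ mass-gap ∕ Clay statement.

v1.1 (same seat; APPEND-ONLY — every v1.0 declaration byte-identical; ONE import added, seat node00-def-P11's `Node00.Record13BgRow` (p490862: `Stage13Params.bg_of_thm1Scaled`
= the BODY of `Provisos₁₃.bg` from the named fact `VariationalThm1Scaled F N B₃ a₀ a₁` = [15] Thm 1 (8) per scale + the numerics clauses + the two displayed gauge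
clauses)): §6 ★★ THE THREE DESKS' JUNCTION IN ONE KERNEL LINE — at ANY Stage-13 parameter carrying K0b's residuals (`θ.HasResidualsOfRecord`), on its live re-pin,
N13's 𝐑-LEAF `ROpLeaf (VOfRecord₁₃ (θ.liveRepin₁₃) p)` (this seat), hence the (R₁₃) law slot, follows from def-P11's ROW-P11 SUPPLIER HYPOTHESES ALONE — the [15] named
fact `h15`, `εreg ≤ a₀`, the per-run numerics clauses `hnum` ∕ `hBα`, the (1.12) ∕ (2.38) gauge clauses `hloc` ∕ `h238` at the minimiser of record — composed through
K0a's `bg_liveRepin₁₃_iff` + `provisos₁₃_liveRepin₁₃_of_bg` ((H-U) = K0c's theorem) and §1's `rOpLeaf_VOfRecord₁₃_liveRepin₁₃` (+ admissibility and the three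
term-constant signs of `θ`): `rOpLeaf_VOfRecord₁₃_liveRepin₁₃_of_thm1Scaled`, `laws₁₃_liveRepin₁₃_of_thm1Scaled`, `provisos₁₃_liveRepin₁₃_of_thm1Scaled` (the
intermediate: `Provisos₁₃` at the re-pin from the same hypotheses — K0‴'s residual in def-P11's currency); §6b the same two faces AT THE NUMERICS-GENERIC WITNESS
`theta13LiveOfNumerics n ε₂₉` (K0b's residuals) in the letters of `n` (`rOpLeaf_VOfRecord₁₃_theta13LiveOfNumerics_of_thm1Scaled`, `laws₁₃_theta13LiveOfNumerics_of_thm1Scaled`)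
— the socket shape at which K0a's [15]-keyed witness `theta13OfThm1` (an instance) discharges the numerics clauses and the signs.
A REDUCTION, not a discharge: every hypothesis is Bałaban's analysis ([15] Thm 1 (8)–(10), [III] (2.7)∕(2.28)∕(2.38)) or a numerics clause of the family, DISPLAYED.
LOCATED, carried verbatim (seat node00-def-P11 LOCATED-P11-SEQ, pub-ymgap INBOX 2026-08-27T04:00:55Z): the (2.18) index of record `SeqOfRecord` carries NO separation of
the domains, while [15] Thm 1 is printed for SEPARATED sequences with comparable thresholds ([Balaban1985RegularSpaces] (1.3)–(1.6), [III] p. 256); hence the named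
fact `VariationalThm1Scaled` AS A HYPOTHESIS is print-STRONGER (def-P11: «plausibly uninhabited for every B₃»), the faithful fact being def-P11's `VariationalThm1ScaledSep`
(FILE 2 v1.1), which supplies `bg` only at separated sequences — a separation-GUARDED token (def-R ∕ def-T option (α)) or a carried stronger fact (option (β)), the
desks' pending call.  §6 ∕ §6b compose what is IN THE TREE today (`Stage13Params.bg_of_thm1Scaled` keyed on `VariationalThm1Scaled`); when the token ∕ fact is re-pointed,
the three theorems re-key BY NAME (same composition, one hypothesis renamed ∕ one guard threaded) — until then read them as «N13's leaf ⟸ WHATEVER SUPPLIES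
`Provisos₁₃.bg`», the supplier's own inhabitation being row P11's open content.
-/

noncomputable section

open MeasureTheory
open scoped BigOperators Matrix.Norms.L2Operator

namespace Literature.MathematicalPhysics.QuantumFieldTheory.Balaban1983to89.B16RLeafRecord13AtLive

open T4Continuum T4DatumAssembly Node00 B14.Eq218Concrete DagBinding
open B16RLeafRecord13Live

variable (F : T4Family) (N : ℕ) [NeZero N]

/-! ## §1  At every Stage-13 live re-pin `θ.liveRepin₁₃`: the selector clause is `rfl`; the leaf, the laws, the node, the (B)-face conjunct, 𝐑 = identity a.e. -/

section Repin

variable (θ : Stage13Params F N) (p : B12.RunParams)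

/-- **THE SELECTOR CLAUSE HOLDS AT THE RE-PIN BY `rfl`** (node00-def-T's §4c binder shape, read at `θ' := θ.liveRepin₁₃ F N` in `θ'`'s own letters).
[cite: Balaban1989LargeFieldI, (0.3) p.176 (bookkeeping); Balaban1988Convergent, (3.22) p.269] -/
theorem liveRepin₁₃_liveSel :
    (θ.liveRepin₁₃ F N).ppSel = ppSelLiveOfRecord F N (θ.liveRepin₁₃ F N).ν (θ.liveRepin₁₃ F N).τ9 (EOfRecord₁₃ F N (θ.liveRepin₁₃ F N))
      (wOfRecord₉ F N (θ.liveRepin₁₃ F N).toStage9Params) := rfl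

/-- **★ THE 𝐑-LEAF OF RECORD AT THE STAGE-13 LIVE RE-PIN** from the provisos at the re-pin, admissibility and the term-constant signs of `θ` ALONE.
[cite: Balaban1988Convergent, p.244, Thm 2 p.263; Balaban1989LargeFieldI, (0.3) p.176, p.177 (i)–(ii); Balaban1989LargeFieldII, Thm 1 p.355 (not exercised)] -/
theorem rOpLeaf_VOfRecord₁₃_liveRepin₁₃ (h : (θ.liveRepin₁₃ F N).Provisos₁₃ F N) (hθ : θ.Admissible F N) (hκ : 0 ≤ θ.s2.lf.κ)
    (hE₀ : 0 ≤ θ.s2.lf.E₀) (hB₀ : 0 ≤ θ.s2.lf.B₀) : ROpLeaf (VOfRecord₁₃ F N (θ.liveRepin₁₃ F N) p) :=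
  rOpLeaf_VOfRecord₁₃_of_liveSel F N (θ.liveRepin₁₃ F N) p h hθ.liveRepin₁₃ hκ hE₀ hB₀ (liveRepin₁₃_liveSel F N θ)

/-- **The leaf in law form at the re-pin** — the (R₁₃) slot of dag-n24-c's `nodes_N11_N13_at_record₁₃` ∕ of seat dag-n11-d's `sLaw₁₃_all_of_tLaw` SUPPLIED.
[cite: Balaban1988Convergent, p.244 (bookkeeping); Balaban1989LargeFieldII, Thm 1 p.355 (not exercised)] -/
theorem laws₁₃_liveRepin₁₃ (h : (θ.liveRepin₁₃ F N).Provisos₁₃ F N) (hθ : θ.Admissible F N) (hκ : 0 ≤ θ.s2.lf.κ) (hE₀ : 0 ≤ θ.s2.lf.E₀)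
    (hB₀ : 0 ≤ θ.s2.lf.B₀) :
    ∀ k, k < p.K → TLaw₁₃ F N (θ.liveRepin₁₃ F N) p k → SLaw₁₃ F N (θ.liveRepin₁₃ F N) p (k + 1) :=
  laws₁₃_of_liveSel F N (θ.liveRepin₁₃ F N) p h hθ.liveRepin₁₃ hκ hE₀ hB₀ (liveRepin₁₃_liveSel F N θ)

/-- **The run's `rOperation` leaf reads TRUE at a world bound to the C-binding of record over the re-pinned Stage-13 view.**
[cite: Balaban1988Convergent, p.244; Balaban1989LargeFieldII, Thm 1 p.355 (bookkeeping at the record)] -/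
theorem rOperation_leavesP_liveRepin₁₃ (w : WorldP) (hup : w.up p = upOfRecord₅C F N ((θ.liveRepin₁₃ F N).toStage5₁₃ F N) p)
    (h : (θ.liveRepin₁₃ F N).Provisos₁₃ F N) (hθ : θ.Admissible F N) (hκ : 0 ≤ θ.s2.lf.κ) (hE₀ : 0 ≤ θ.s2.lf.E₀) (hB₀ : 0 ≤ θ.s2.lf.B₀) :
    (leavesP w p).rOperation :=
  rOperation_leavesP_of_liveSel₁₃ F N (θ.liveRepin₁₃ F N) p w hup h hθ.liveRepin₁₃ hκ hE₀ hB₀ (liveRepin₁₃_liveSel F N θ)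

/-- **AT THE RE-PIN, A NON-LIVE SEQUENCE IS ABSENT FROM `ρ_{k+1}`** (K0a's `LiveSeq` currency), no proviso.
[cite: Balaban1989LargeFieldI, (0.3) p.176, p.177 (i)–(ii); Balaban1988Convergent, (2.17)–(2.18) p.257] -/
theorem slotsOfRecord_liveRepin₁₃_succ_eq_zero_of_not_liveSeq (k : ℕ)
    (s : SeqOfRecord F θ.ν θ.τ9.M (gOfRecord₁₃ F N θ p) p.K (k + 1))
    (hs : ¬ LiveSeq F N θ.ν θ.τ9 p (gOfRecord₁₃ F N θ p) (k + 1)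
      (slotsTOfRecord F N θ.ν θ.τ9 (EOfRecord₁₃ F N θ) (wOfRecord₉ F N θ.toStage9Params) (θ.liveRepin₁₃ F N).ppSel p (gOfRecord₁₃ F N θ p) (k + 1)) s) :
    slotsOfRecord F N θ.ν θ.τ9 (EOfRecord₁₃ F N θ) (wOfRecord₉ F N θ.toStage9Params) (θ.liveRepin₁₃ F N).ppSel p (gOfRecord₁₃ F N θ p) (k + 1) s = 0 :=
  slotsOfRecord₁₃_succ_eq_zero_of_not_liveSeq_of_liveSel F N (θ.liveRepin₁₃ F N) (liveRepin₁₃_liveSel F N θ) p k s hs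

/-- **THEOREM 1 [III] AT THE RE-PINNED OBJECTS OF RECORD FROM THE FULL (S1ᵀ)** (law reading). [cite: Balaban1988Convergent, Thm 1 p.262; Theorem p.245; p.244] -/
theorem sLaw₁₃_all_liveRepin₁₃_of_thmP245 (h : (θ.liveRepin₁₃ F N).Provisos₁₃ F N) (hθ : θ.Admissible F N) (hκ : 0 ≤ θ.s2.lf.κ) (hE₀ : 0 ≤ θ.s2.lf.E₀)
    (hB₀ : 0 ≤ θ.s2.lf.B₀) (hT : ∀ k, k < p.K → SLaw₁₃ F N (θ.liveRepin₁₃ F N) p k → TLaw₁₃ F N (θ.liveRepin₁₃ F N) p k) :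
    ∀ k, k ≤ p.K → SLaw₁₃ F N (θ.liveRepin₁₃ F N) p k :=
  sLaw₁₃_all_of_thmP245_of_liveSel F N (θ.liveRepin₁₃ F N) p h hθ.liveRepin₁₃ hκ hE₀ hB₀ (liveRepin₁₃_liveSel F N θ) hT

/-- **★ THEOREM 1 [III] AT THE RE-PINNED OBJECTS OF RECORD FROM (S1ᵀ) AT THE LIVE SEQUENCES ONLY.**
[cite: Balaban1988Convergent, Thm 1 p.262; Theorem p.245; p.244; Balaban1989LargeFieldI, (0.3) p.176, p.177 (i)–(ii)] -/
theorem sLaw₁₃_all_liveRepin₁₃_of_thmP245LiveSeq (h : (θ.liveRepin₁₃ F N).Provisos₁₃ F N) (hθ : θ.Admissible F N) (hκ : 0 ≤ θ.s2.lf.κ)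
    (hE₀ : 0 ≤ θ.s2.lf.E₀) (hB₀ : 0 ≤ θ.s2.lf.B₀)
    (hT : ∀ k, k < p.K → SLaw₁₃ F N (θ.liveRepin₁₃ F N) p k →
      ∃ (t : SeqOfRecord F θ.ν θ.τ9.M (gOfRecord₁₃ F N θ p) p.K (k + 1) → Sect2.TermValues (F.P p.K) (MatA N) (FluctV N) θ.τ9.M)
      (Ek : SeqOfRecord F θ.ν θ.τ9.M (gOfRecord₁₃ F N θ p) p.K (k + 1) → ℝ), Sect2.UniversalE t ∧
      ∀ s, Sect2.LawsT (sect2TowerOfRecord F N (FluctV N) p.K (settingOfRecord₁₃ F N (θ.liveRepin₁₃ F N) p) (θ.Rz p.K) s (t s))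
          (settingOfRecord₁₃ F N (θ.liveRepin₁₃ F N) p).lf (settingOfRecord₁₃ F N (θ.liveRepin₁₃ F N) p).βc k ∧
        (LiveSeq F N θ.ν θ.τ9 p (gOfRecord₁₃ F N θ p) (k + 1)
            (slotsTOfRecord F N θ.ν θ.τ9 (EOfRecord₁₃ F N θ) (wOfRecord₉ F N θ.toStage9Params) (θ.liveRepin₁₃ F N).ppSel p
              (gOfRecord₁₃ F N θ p) (k + 1)) s →
          (slotsTOfRecord F N θ.ν θ.τ9 (EOfRecord₁₃ F N θ) (wOfRecord₉ F N θ.toStage9Params) (θ.liveRepin₁₃ F N).ppSel p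
              (gOfRecord₁₃ F N θ p) (k + 1) s = 0 ∨
            ∀ᵐ V ∂(fieldMeasure (F.P p.K) (k + 1) (SU N)), chiSeqOfRecord F N θ.ν θ.τ9.M (gOfRecord₁₃ F N θ p) p.K (k + 1) s V ≠ 0 →
              slotsTOfRecord F N θ.ν θ.τ9 (EOfRecord₁₃ F N θ) (wOfRecord₉ F N θ.toStage9Params) (θ.liveRepin₁₃ F N).ppSel p
                  (gOfRecord₁₃ F N θ p) (k + 1) s V
                = sect2Slot F N (FluctV N) p.K (settingOfRecord₁₃ F N (θ.liveRepin₁₃ F N) p) (θ.Rz p.K) (WtOfRecord₁₃ F N (θ.liveRepin₁₃ F N) p) s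
                    (t s) (Ek s) (UbgOfRecord₁₃ F N (θ.liveRepin₁₃ F N) p (k + 1) s) V))) :
    ∀ k, k ≤ p.K → SLaw₁₃ F N (θ.liveRepin₁₃ F N) p k :=
  sLaw₁₃_all_of_thmP245LiveSeq_of_liveSel F N (θ.liveRepin₁₃ F N) p h hθ.liveRepin₁₃ hκ hE₀ hB₀ (liveRepin₁₃_liveSel F N θ) hT

variable (w : WorldP) (h : (θ.liveRepin₁₃ F N).Provisos₁₃ F N)

/-- **N11 · `Dag.B14_main (leavesP w P)` AT A WORLD BOUND TO THE RE-PINNED DATUM — ONE DISPLAYED SLOT (S1ᵀ), NO 𝐑-READING HYPOTHESIS.**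
[cite: Balaban1988Convergent, Thm 1 p.262; Theorem p.245; p.244; (2.6) p.255] -/
theorem b14_main_at_record₁₃_liveRepin₁₃ (hC : w.C = (datumOfRecord₁₃ F N (θ.liveRepin₁₃ F N) h).C) (hθ : θ.Admissible F N) (hκ : 0 ≤ θ.s2.lf.κ)
    (hE₀ : 0 ≤ θ.s2.lf.E₀) (hB₀ : 0 ≤ θ.s2.lf.B₀)
    (hT : (leavesP w p).b7 → (leavesP w p).b8 → (leavesP w p).b9 → (leavesP w p).b10 → (leavesP w p).b11 →
      (leavesP w p).smallCouplings → (leavesP w p).smallFieldInductive → (leavesP w p).flowControl →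
        ∀ k, k < p.K → SLaw₁₃ F N (θ.liveRepin₁₃ F N) p k → TLaw₁₃ F N (θ.liveRepin₁₃ F N) p k) :
    Dag.B14_main (leavesP w p) :=
  b14_main_at_record₁₃_of_liveSel F N (θ.liveRepin₁₃ F N) p w h hC hθ.liveRepin₁₃ hκ hE₀ hB₀ (liveRepin₁₃_liveSel F N θ) hT

/-- **N11 · `Dag.B14_main (leavesP w P)` AT THE RE-PIN FROM (S1ᵀ) AT THE LIVE SEQUENCES ONLY.**
[cite: Balaban1988Convergent, Thm 1 p.262; Theorem p.245; (2.6) p.255; Balaban1989LargeFieldI, (0.3) p.176, p.177 (i)–(ii)] -/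
theorem b14_main_at_record₁₃_liveRepin₁₃_of_lawsLive (hC : w.C = (datumOfRecord₁₃ F N (θ.liveRepin₁₃ F N) h).C) (hθ : θ.Admissible F N)
    (hκ : 0 ≤ θ.s2.lf.κ) (hE₀ : 0 ≤ θ.s2.lf.E₀) (hB₀ : 0 ≤ θ.s2.lf.B₀)
    (hT : (leavesP w p).b7 → (leavesP w p).b8 → (leavesP w p).b9 → (leavesP w p).b10 → (leavesP w p).b11 →
      (leavesP w p).smallCouplings → (leavesP w p).smallFieldInductive → (leavesP w p).flowControl →
      ∀ k, k < p.K → SLaw₁₃ F N (θ.liveRepin₁₃ F N) p k →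
      ∃ (t : SeqOfRecord F θ.ν θ.τ9.M (gOfRecord₁₃ F N θ p) p.K (k + 1) → Sect2.TermValues (F.P p.K) (MatA N) (FluctV N) θ.τ9.M)
      (Ek : SeqOfRecord F θ.ν θ.τ9.M (gOfRecord₁₃ F N θ p) p.K (k + 1) → ℝ), Sect2.UniversalE t ∧
      ∀ s, Sect2.LawsT (sect2TowerOfRecord F N (FluctV N) p.K (settingOfRecord₁₃ F N (θ.liveRepin₁₃ F N) p) (θ.Rz p.K) s (t s))
          (settingOfRecord₁₃ F N (θ.liveRepin₁₃ F N) p).lf (settingOfRecord₁₃ F N (θ.liveRepin₁₃ F N) p).βc k ∧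
        (LiveSeq F N θ.ν θ.τ9 p (gOfRecord₁₃ F N θ p) (k + 1)
            (slotsTOfRecord F N θ.ν θ.τ9 (EOfRecord₁₃ F N θ) (wOfRecord₉ F N θ.toStage9Params) (θ.liveRepin₁₃ F N).ppSel p
              (gOfRecord₁₃ F N θ p) (k + 1)) s →
          (slotsTOfRecord F N θ.ν θ.τ9 (EOfRecord₁₃ F N θ) (wOfRecord₉ F N θ.toStage9Params) (θ.liveRepin₁₃ F N).ppSel p
              (gOfRecord₁₃ F N θ p) (k + 1) s = 0 ∨
            ∀ᵐ V ∂(fieldMeasure (F.P p.K) (k + 1) (SU N)), chiSeqOfRecord F N θ.ν θ.τ9.M (gOfRecord₁₃ F N θ p) p.K (k + 1) s V ≠ 0 →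
              slotsTOfRecord F N θ.ν θ.τ9 (EOfRecord₁₃ F N θ) (wOfRecord₉ F N θ.toStage9Params) (θ.liveRepin₁₃ F N).ppSel p
                  (gOfRecord₁₃ F N θ p) (k + 1) s V
                = sect2Slot F N (FluctV N) p.K (settingOfRecord₁₃ F N (θ.liveRepin₁₃ F N) p) (θ.Rz p.K) (WtOfRecord₁₃ F N (θ.liveRepin₁₃ F N) p) s
                    (t s) (Ek s) (UbgOfRecord₁₃ F N (θ.liveRepin₁₃ F N) p (k + 1) s) V))) :
    Dag.B14_main (leavesP w p) :=
  b14_main_at_record₁₃_of_lawsLive_of_liveSel F N (θ.liveRepin₁₃ F N) p w h hC hθ.liveRepin₁₃ hκ hE₀ hB₀ (liveRepin₁₃_liveSel F N θ) hT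

/-- **N11 in the K1-class binder shape at the re-pin** (world with `IsRecordOfRecord₁₃C F N (datumOfRecord₁₃ F N θ.liveRepin₁₃ h) w`).
[cite: Balaban1988Convergent, Thm 1 p.262; Theorem p.245; p.244 (bookkeeping at the record)] -/
theorem b14_main_of_isRecordOfRecord₁₃C_datum_liveRepin₁₃ (hrec : IsRecordOfRecord₁₃C F N (datumOfRecord₁₃ F N (θ.liveRepin₁₃ F N) h) w)
    (hθ : θ.Admissible F N) (hκ : 0 ≤ θ.s2.lf.κ) (hE₀ : 0 ≤ θ.s2.lf.E₀) (hB₀ : 0 ≤ θ.s2.lf.B₀)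
    (hT : ∀ P : B12.RunParams, (leavesP w P).b7 → (leavesP w P).b8 → (leavesP w P).b9 → (leavesP w P).b10 → (leavesP w P).b11 →
      (leavesP w P).smallCouplings → (leavesP w P).smallFieldInductive → (leavesP w P).flowControl →
        ∀ k, k < P.K → SLaw₁₃ F N (θ.liveRepin₁₃ F N) P k → TLaw₁₃ F N (θ.liveRepin₁₃ F N) P k) (P : B12.RunParams) :
    Dag.B14_main (leavesP w P) :=
  b14_main_of_isRecordOfRecord₁₃C_datum_of_liveSel F N (θ.liveRepin₁₃ F N) w h hrec hθ.liveRepin₁₃ hκ hE₀ hB₀ (liveRepin₁₃_liveSel F N θ) hT P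

/-- **★ THE (B)-FACE's FIRST CONJUNCT `B16.Thm1Printed (datumOfRecord₁₃ F N θ.liveRepin₁₃ h).C` FROM THE FULL (S1ᵀ) along the windowed runs** (leaf SUPPLIED).
[cite: Balaban1989LargeFieldII, Thm 1 p.355; Balaban1988Convergent, Thm 1 p.262; Theorem p.245; p.244] -/
theorem thm1Printed_datumOfRecord₁₃_liveRepin₁₃_of_laws (hθ : θ.Admissible F N) (hκ : 0 ≤ θ.s2.lf.κ) (hE₀ : 0 ≤ θ.s2.lf.E₀) (hB₀ : 0 ≤ θ.s2.lf.B₀)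
    {γ : ℝ} (hγ : 0 < γ)
    (hT : ∀ P : B12.RunParams, ((datumOfRecord₁₃ F N (θ.liveRepin₁₃ F N) h).C P).flow.InInterval γ P.K →
      ∀ k, k < P.K → SLaw₁₃ F N (θ.liveRepin₁₃ F N) P k → TLaw₁₃ F N (θ.liveRepin₁₃ F N) P k) :
    B16.Thm1Printed (datumOfRecord₁₃ F N (θ.liveRepin₁₃ F N) h).C :=
  thm1Printed_datumOfRecord₁₃_of_laws_of_liveSel F N (θ.liveRepin₁₃ F N) h hθ.liveRepin₁₃ hκ hE₀ hB₀ (liveRepin₁₃_liveSel F N θ) hγ hT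

/-- **★ THE (B)-FACE's FIRST CONJUNCT AT THE RE-PIN FROM (S1ᵀ) AT THE LIVE SEQUENCES ONLY** (`0 < γ`, along the windowed runs).
[cite: Balaban1989LargeFieldII, Thm 1 p.355 + p.391; Balaban1988Convergent, Thm 1 p.262; Theorem p.245; Balaban1989LargeFieldI, (0.3) p.176, p.177 (i)–(ii)] -/
theorem thm1Printed_datumOfRecord₁₃_liveRepin₁₃_of_lawsLive (hθ : θ.Admissible F N) (hκ : 0 ≤ θ.s2.lf.κ) (hE₀ : 0 ≤ θ.s2.lf.E₀)
    (hB₀ : 0 ≤ θ.s2.lf.B₀) {γ : ℝ} (hγ : 0 < γ)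
    (hT : ∀ P : B12.RunParams, ((datumOfRecord₁₃ F N (θ.liveRepin₁₃ F N) h).C P).flow.InInterval γ P.K → ∀ k, k < P.K →
      SLaw₁₃ F N (θ.liveRepin₁₃ F N) P k →
      ∃ (t : SeqOfRecord F θ.ν θ.τ9.M (gOfRecord₁₃ F N θ P) P.K (k + 1) → Sect2.TermValues (F.P P.K) (MatA N) (FluctV N) θ.τ9.M)
      (Ek : SeqOfRecord F θ.ν θ.τ9.M (gOfRecord₁₃ F N θ P) P.K (k + 1) → ℝ), Sect2.UniversalE t ∧
      ∀ s, Sect2.LawsT (sect2TowerOfRecord F N (FluctV N) P.K (settingOfRecord₁₃ F N (θ.liveRepin₁₃ F N) P) (θ.Rz P.K) s (t s))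
          (settingOfRecord₁₃ F N (θ.liveRepin₁₃ F N) P).lf (settingOfRecord₁₃ F N (θ.liveRepin₁₃ F N) P).βc k ∧
        (LiveSeq F N θ.ν θ.τ9 P (gOfRecord₁₃ F N θ P) (k + 1)
            (slotsTOfRecord F N θ.ν θ.τ9 (EOfRecord₁₃ F N θ) (wOfRecord₉ F N θ.toStage9Params) (θ.liveRepin₁₃ F N).ppSel P
              (gOfRecord₁₃ F N θ P) (k + 1)) s →
          (slotsTOfRecord F N θ.ν θ.τ9 (EOfRecord₁₃ F N θ) (wOfRecord₉ F N θ.toStage9Params) (θ.liveRepin₁₃ F N).ppSel P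
              (gOfRecord₁₃ F N θ P) (k + 1) s = 0 ∨
            ∀ᵐ V ∂(fieldMeasure (F.P P.K) (k + 1) (SU N)), chiSeqOfRecord F N θ.ν θ.τ9.M (gOfRecord₁₃ F N θ P) P.K (k + 1) s V ≠ 0 →
              slotsTOfRecord F N θ.ν θ.τ9 (EOfRecord₁₃ F N θ) (wOfRecord₉ F N θ.toStage9Params) (θ.liveRepin₁₃ F N).ppSel P
                  (gOfRecord₁₃ F N θ P) (k + 1) s V
                = sect2Slot F N (FluctV N) P.K (settingOfRecord₁₃ F N (θ.liveRepin₁₃ F N) P) (θ.Rz P.K) (WtOfRecord₁₃ F N (θ.liveRepin₁₃ F N) P) s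
                    (t s) (Ek s) (UbgOfRecord₁₃ F N (θ.liveRepin₁₃ F N) P (k + 1) s) V))) :
    B16.Thm1Printed (datumOfRecord₁₃ F N (θ.liveRepin₁₃ F N) h).C :=
  thm1Printed_datumOfRecord₁₃_of_lawsLive_of_liveSel F N (θ.liveRepin₁₃ F N) h hθ.liveRepin₁₃ hκ hE₀ hB₀ (liveRepin₁₃_liveSel F N θ) hγ hT

/-- **★ AT THE RE-PIN, `ρ_{k+1} = 𝐓ρ_k` ALMOST EVERYWHERE**, `k < K` — 𝐑 OF RECORD IS THE IDENTITY UP TO NULL SETS at every Stage-13 live re-pin (from `Provisos₁₃` there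
alone). [cite: Balaban1989LargeFieldI, (0.2)–(0.4) p.176, p.177 (i)–(ii); Balaban1988Convergent, Thm 1 p.262, (3.24)–(3.25) p.270; Balaban1989LargeFieldII, Thm 1 p.355 (not exercised)] -/
theorem densOfRecord₁₃_succ_ae_eq_tdens_liveRepin₁₃ (hP : (θ.liveRepin₁₃ F N).Provisos₁₃ F N) (k : ℕ) (hk : k < p.K) :
    densOfRecord₁₃ F N (θ.liveRepin₁₃ F N) p (k + 1) =ᵐ[fieldMeasure (F.P p.K) (k + 1) (SU N)] tdensOfRecord₁₃ F N (θ.liveRepin₁₃ F N) p k :=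
  densOfRecord₁₃_succ_ae_eq_tdens_of_liveSel F N (θ.liveRepin₁₃ F N) p hP (liveRepin₁₃_liveSel F N θ) k hk

end Repin

/-! ## §2  At node00-def-K0a's family witness `θ₁₃(ε₀) = theta13LiveOfFamily F N ε₀ ζ Rz Zt`: admissibility and the term-constant signs DISCHARGED -/

section Family

variable (ε₀ : ℝ) (ζ : ZetaOfRecord F N (numerics7OfFamily ε₀) 1) (Rz : (K : ℕ) → Sect2.Residual (F.P K) (MatA N))
  (Zt : (K : ℕ) → TkResidualW F N (FluctV N) K) (p : B12.RunParams)

/-- `θ₁₃(ε₀)`'s decay rate is `κ = 2·10⁴ ≥ 0`. [cite: Balaban1987RG1, (1.18) p.263 (bookkeeping witness)] -/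
theorem kappa_nonneg_theta13LiveOfFamily : 0 ≤ (theta13LiveOfFamily F N ε₀ ζ Rz Zt).s2.lf.κ := by
  rw [theta13LiveOfFamily_κ]; norm_num

/-- `θ₁₃(ε₀)`'s term constants have `E₀ = 1 ≥ 0`. [cite: Balaban1988Convergent, (2.31) p.260 (bookkeeping witness)] -/
theorem E0_nonneg_theta13LiveOfFamily : 0 ≤ (theta13LiveOfFamily F N ε₀ ζ Rz Zt).s2.lf.E₀ := by
  have hE : (theta13LiveOfFamily F N ε₀ ζ Rz Zt).s2.lf.E₀ = 1 := rfl
  rw [hE]; exact zero_le_one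

/-- `θ₁₃(ε₀)`'s term constants have `B₀ = 1 ≥ 0`. [cite: Balaban1988Convergent, (2.42) p.261 (bookkeeping witness)] -/
theorem B0_nonneg_theta13LiveOfFamily : 0 ≤ (theta13LiveOfFamily F N ε₀ ζ Rz Zt).s2.lf.B₀ := by
  have hB : (theta13LiveOfFamily F N ε₀ ζ Rz Zt).s2.lf.B₀ = 1 := rfl
  rw [hB]; exact zero_le_one

variable {ε₀}

/-- **★ THE 𝐑-LEAF OF RECORD AT THE STAGE-13 FAMILY WITNESS FROM THE PROVISOS ALONE** (`0 < ε₀`; admissibility by K0a's `admissible_theta13OfFamily`, signs by the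
family's numerals): `Provisos₁₃ θ₁₃(ε₀) ⊢ ROpLeaf (VOfRecord₁₃ θ₁₃(ε₀) p)` — N13's conjunct on the K0″ family line costs exactly K0″'s own residual.
[cite: Balaban1988Convergent, p.244, Thm 2 p.263; Balaban1989LargeFieldI, (0.3) p.176, p.177 (i)–(ii); Balaban1989LargeFieldII, Thm 1 p.355 (not exercised)] -/
theorem rOpLeaf_VOfRecord₁₃_theta13LiveOfFamily_of_provisos (hε : 0 < ε₀) (h : (theta13LiveOfFamily F N ε₀ ζ Rz Zt).Provisos₁₃ F N) :
    ROpLeaf (VOfRecord₁₃ F N (theta13LiveOfFamily F N ε₀ ζ Rz Zt) p) :=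
  rOpLeaf_VOfRecord₁₃_liveRepin₁₃ F N (theta13OfFamily F N ε₀ ζ Rz Zt) p h (admissible_theta13OfFamily F N ζ Rz Zt hε)
    (kappa_nonneg_theta13LiveOfFamily F N ε₀ ζ Rz Zt) (E0_nonneg_theta13LiveOfFamily F N ε₀ ζ Rz Zt) (B0_nonneg_theta13LiveOfFamily F N ε₀ ζ Rz Zt)

/-- **The (R₁₃) slot in law form at the family witness, from the provisos alone.** [cite: Balaban1988Convergent, p.244 (bookkeeping); Balaban1989LargeFieldII, Thm 1 p.355 (not exercised)] -/
theorem laws₁₃_theta13LiveOfFamily_of_provisos (hε : 0 < ε₀) (h : (theta13LiveOfFamily F N ε₀ ζ Rz Zt).Provisos₁₃ F N) :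
    ∀ k, k < p.K → TLaw₁₃ F N (theta13LiveOfFamily F N ε₀ ζ Rz Zt) p k → SLaw₁₃ F N (theta13LiveOfFamily F N ε₀ ζ Rz Zt) p (k + 1) :=
  (rOpLeaf_VOfRecord₁₃_iff F N _ p).mp (rOpLeaf_VOfRecord₁₃_theta13LiveOfFamily_of_provisos F N ζ Rz Zt p hε h)

/-- **`ρ_{k+1} = 𝐓ρ_k` a.e. at the family witness**, `k < K`. [cite: Balaban1989LargeFieldI, (0.2)–(0.4) p.176, p.177 (i)–(ii); Balaban1988Convergent, (3.24)–(3.25) p.270] -/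
theorem densOfRecord₁₃_succ_ae_eq_tdens_theta13LiveOfFamily (h : (theta13LiveOfFamily F N ε₀ ζ Rz Zt).Provisos₁₃ F N) (k : ℕ) (hk : k < p.K) :
    densOfRecord₁₃ F N (theta13LiveOfFamily F N ε₀ ζ Rz Zt) p (k + 1) =ᵐ[fieldMeasure (F.P p.K) (k + 1) (SU N)]
      tdensOfRecord₁₃ F N (theta13LiveOfFamily F N ε₀ ζ Rz Zt) p k :=
  densOfRecord₁₃_succ_ae_eq_tdens_liveRepin₁₃ F N (theta13OfFamily F N ε₀ ζ Rz Zt) p h k hk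

variable (h : (theta13LiveOfFamily F N ε₀ ζ Rz Zt).Provisos₁₃ F N)

/-- **★ THE (B)-FACE's FIRST CONJUNCT AT THE FAMILY WITNESS FROM THE FULL (S1ᵀ) along the windowed runs** (`0 < ε₀`, `0 < γ`; leaf and signs SUPPLIED).
[cite: Balaban1989LargeFieldII, Thm 1 p.355; Balaban1988Convergent, Thm 1 p.262; Theorem p.245; p.244] -/
theorem thm1Printed_datumOfRecord₁₃_theta13LiveOfFamily_of_laws (hε : 0 < ε₀) {γ : ℝ} (hγ : 0 < γ)
    (hT : ∀ P : B12.RunParams, ((datumOfRecord₁₃ F N (theta13LiveOfFamily F N ε₀ ζ Rz Zt) h).C P).flow.InInterval γ P.K →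
      ∀ k, k < P.K → SLaw₁₃ F N (theta13LiveOfFamily F N ε₀ ζ Rz Zt) P k → TLaw₁₃ F N (theta13LiveOfFamily F N ε₀ ζ Rz Zt) P k) :
    B16.Thm1Printed (datumOfRecord₁₃ F N (theta13LiveOfFamily F N ε₀ ζ Rz Zt) h).C :=
  thm1Printed_datumOfRecord₁₃_liveRepin₁₃_of_laws F N (theta13OfFamily F N ε₀ ζ Rz Zt) h (admissible_theta13OfFamily F N ζ Rz Zt hε)
    (kappa_nonneg_theta13LiveOfFamily F N ε₀ ζ Rz Zt) (E0_nonneg_theta13LiveOfFamily F N ε₀ ζ Rz Zt) (B0_nonneg_theta13LiveOfFamily F N ε₀ ζ Rz Zt) hγ hT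

variable (w : WorldP)

/-- **N11 · `Dag.B14_main (leavesP w P)` AT A WORLD BOUND TO THE FAMILY WITNESS's DATUM — ONE DISPLAYED SLOT (S1ᵀ), NOTHING ELSE but `0 < ε₀`.**
[cite: Balaban1988Convergent, Thm 1 p.262; Theorem p.245; p.244; (2.6) p.255] -/
theorem b14_main_at_record₁₃_theta13LiveOfFamily (hε : 0 < ε₀) (hC : w.C = (datumOfRecord₁₃ F N (theta13LiveOfFamily F N ε₀ ζ Rz Zt) h).C)
    (hT : (leavesP w p).b7 → (leavesP w p).b8 → (leavesP w p).b9 → (leavesP w p).b10 → (leavesP w p).b11 →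
      (leavesP w p).smallCouplings → (leavesP w p).smallFieldInductive → (leavesP w p).flowControl →
        ∀ k, k < p.K → SLaw₁₃ F N (theta13LiveOfFamily F N ε₀ ζ Rz Zt) p k → TLaw₁₃ F N (theta13LiveOfFamily F N ε₀ ζ Rz Zt) p k) :
    Dag.B14_main (leavesP w p) :=
  b14_main_at_record₁₃_liveRepin₁₃ F N (theta13OfFamily F N ε₀ ζ Rz Zt) p w h hC (admissible_theta13OfFamily F N ζ Rz Zt hε)
    (kappa_nonneg_theta13LiveOfFamily F N ε₀ ζ Rz Zt) (E0_nonneg_theta13LiveOfFamily F N ε₀ ζ Rz Zt) (B0_nonneg_theta13LiveOfFamily F N ε₀ ζ Rz Zt) hT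

end Family

/-! ## §3  At the Stage-13 WITNESS OF RECORD `θ₁₃ = theta13LiveOfRecord F N`: every face hypothesis-free up to `Provisos₁₃` — and, through K0a's one-row reduction
`provisos₁₃_theta13LiveOfRecord_of_bg`, up to ROW P11 `bg` ALONE -/

section OfRecord

variable (p : B12.RunParams)

/-- **★ THE 𝐑-LEAF OF RECORD AT THE WITNESS OF RECORD FROM `Provisos₁₃` THERE, ALONE.** [cite: Balaban1988Convergent, p.244, Thm 2 p.263; Balaban1989LargeFieldI, (0.3) p.176, p.177 (i)–(ii); Balaban1989LargeFieldII, Thm 1 p.355 (not exercised)] -/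
theorem rOpLeaf_VOfRecord₁₃_theta13LiveOfRecord_of_provisos (h : (theta13LiveOfRecord F N).Provisos₁₃ F N) :
    ROpLeaf (VOfRecord₁₃ F N (theta13LiveOfRecord F N) p) :=
  rOpLeaf_VOfRecord₁₃_theta13LiveOfFamily_of_provisos F N _ _ _ p eps0OfRecord₁₃_pos h

/-- **★★ THE 𝐑-LEAF OF RECORD AT THE WITNESS OF RECORD FROM ROW P11 `bg` ALONE** (K0a's `provisos₁₃_theta13LiveOfRecord_of_bg`: every other `Provisos₁₃` field is a
theorem at the witness; the hypothesis is the text of `Provisos₁₃.bg` there — the RANGED token `BgProvisoΛ`, seat node00-def-P11's [III] (2.7) + [15] Thm 1 row):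
ON THE K0″ WITNESS LINE, N13's CONJUNCT `ROpLeaf` COSTS EXACTLY ROW P11.  A REDUCTION, not a discharge. [cite: Balaban1988Convergent, p.244, (2.7) p.255, (2.28) p.259, Thm 2 p.263; Balaban1989LargeFieldI, (0.3) p.176, p.177 (i)–(ii); Balaban1989LargeFieldII, Thm 1 p.355 (not exercised)] -/
theorem rOpLeaf_VOfRecord₁₃_theta13LiveOfRecord_of_bg
    (hbg : ∀ (p : B12.RunParams) (n : ℕ), n ≤ p.K → Step.InInterval (theta13LiveOfRecord F N).γ n (gOfRecord₁₃ F N (theta13LiveOfRecord F N) p) →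
      BgProvisoΛ F N p.K (settingOfRecord₁₃ F N (theta13LiveOfRecord F N) p) ((theta13LiveOfRecord F N).Rz p.K) (theta13LiveOfRecord F N).τ9.M n
        (suppOfRecord₁₃ F N (theta13LiveOfRecord F N) p n) (UbgOfRecord₁₃ F N (theta13LiveOfRecord F N) p n)) :
    ROpLeaf (VOfRecord₁₃ F N (theta13LiveOfRecord F N) p) :=
  rOpLeaf_VOfRecord₁₃_theta13LiveOfRecord_of_provisos F N p (provisos₁₃_theta13LiveOfRecord_of_bg F N hbg)

/-- **The (R₁₃) slot in law form at the witness of record, from `Provisos₁₃` there alone** (the `hR13` slot of n24-c's Stage-13 knit ∕ of n11-d's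
`sLaw₁₃_all_of_tLaw` at the witness). [cite: Balaban1988Convergent, p.244 (bookkeeping); Balaban1989LargeFieldII, Thm 1 p.355 (not exercised)] -/
theorem laws₁₃_theta13LiveOfRecord_of_provisos (h : (theta13LiveOfRecord F N).Provisos₁₃ F N) :
    ∀ k, k < p.K → TLaw₁₃ F N (theta13LiveOfRecord F N) p k → SLaw₁₃ F N (theta13LiveOfRecord F N) p (k + 1) :=
  (rOpLeaf_VOfRecord₁₃_iff F N _ p).mp (rOpLeaf_VOfRecord₁₃_theta13LiveOfRecord_of_provisos F N p h)

/-- **The run's `rOperation` leaf reads TRUE at every world bound to the C-binding of record over the witness's Stage-13 view, from `Provisos₁₃` alone.**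
[cite: Balaban1988Convergent, p.244; Balaban1989LargeFieldII, Thm 1 p.355 (bookkeeping at the record)] -/
theorem rOperation_leavesP_theta13LiveOfRecord_of_provisos (w : WorldP)
    (hup : w.up p = upOfRecord₅C F N ((theta13LiveOfRecord F N).toStage5₁₃ F N) p) (h : (theta13LiveOfRecord F N).Provisos₁₃ F N) :
    (leavesP w p).rOperation := by
  show (w.up p).rOperation
  rw [hup, rOperation_upOfRecord₅C_stage13_iff]
  exact laws₁₃_theta13LiveOfRecord_of_provisos F N p h

/-- **`ρ_{k+1} = 𝐓ρ_k` a.e. at the witness of record**, `k < K`: 𝐑 of record is the identity up to null sets ON THE K0″ WITNESS LINE.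
[cite: Balaban1989LargeFieldI, (0.2)–(0.4) p.176, p.177 (i)–(ii); Balaban1988Convergent, (3.24)–(3.25) p.270; Balaban1989LargeFieldII, Thm 1 p.355 (not exercised)] -/
theorem densOfRecord₁₃_succ_ae_eq_tdens_theta13LiveOfRecord (h : (theta13LiveOfRecord F N).Provisos₁₃ F N) (k : ℕ) (hk : k < p.K) :
    densOfRecord₁₃ F N (theta13LiveOfRecord F N) p (k + 1) =ᵐ[fieldMeasure (F.P p.K) (k + 1) (SU N)] tdensOfRecord₁₃ F N (theta13LiveOfRecord F N) p k :=
  densOfRecord₁₃_succ_ae_eq_tdens_theta13LiveOfFamily F N _ _ _ p h k hk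

variable (h : (theta13LiveOfRecord F N).Provisos₁₃ F N) (w : WorldP)

/-- **N11 · `Dag.B14_main (leavesP w P)` AT A WORLD BOUND TO THE WITNESS OF RECORD's DATUM — ONE DISPLAYED SLOT (S1ᵀ), NOTHING ELSE.**
[cite: Balaban1988Convergent, Thm 1 p.262; Theorem p.245; p.244; (2.6) p.255] -/
theorem b14_main_at_record₁₃_theta13LiveOfRecord (hC : w.C = (datumOfRecord₁₃ F N (theta13LiveOfRecord F N) h).C)
    (hT : (leavesP w p).b7 → (leavesP w p).b8 → (leavesP w p).b9 → (leavesP w p).b10 → (leavesP w p).b11 →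
      (leavesP w p).smallCouplings → (leavesP w p).smallFieldInductive → (leavesP w p).flowControl →
        ∀ k, k < p.K → SLaw₁₃ F N (theta13LiveOfRecord F N) p k → TLaw₁₃ F N (theta13LiveOfRecord F N) p k) :
    Dag.B14_main (leavesP w p) :=
  b14_main_at_record₁₃_theta13LiveOfFamily F N _ _ _ p h w eps0OfRecord₁₃_pos hC hT

/-- **★ THE (B)-FACE's FIRST CONJUNCT `B16.Thm1Printed (datumOfRecord₁₃ F N θ₁₃ h).C` AT THE WITNESS OF RECORD FROM THE FULL (S1ᵀ) along the windowed runs, NOTHING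
ELSE** (`0 < γ`). [cite: Balaban1989LargeFieldII, Thm 1 p.355; Balaban1988Convergent, Thm 1 p.262; Theorem p.245; p.244] -/
theorem thm1Printed_datumOfRecord₁₃_theta13LiveOfRecord_of_laws {γ : ℝ} (hγ : 0 < γ)
    (hT : ∀ P : B12.RunParams, ((datumOfRecord₁₃ F N (theta13LiveOfRecord F N) h).C P).flow.InInterval γ P.K →
      ∀ k, k < P.K → SLaw₁₃ F N (theta13LiveOfRecord F N) P k → TLaw₁₃ F N (theta13LiveOfRecord F N) P k) :
    B16.Thm1Printed (datumOfRecord₁₃ F N (theta13LiveOfRecord F N) h).C :=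
  thm1Printed_datumOfRecord₁₃_theta13LiveOfFamily_of_laws F N _ _ _ h eps0OfRecord₁₃_pos hγ hT

/-- **★ THE (B)-FACE's FIRST CONJUNCT AT THE WITNESS OF RECORD FROM (S1ᵀ) AT THE LIVE SEQUENCES ONLY** (K0a's `LiveSeq` currency; `0 < γ`; along the windowed runs) —
N11's EXACT share of the K1-class (B)-face on the witness line. [cite: Balaban1989LargeFieldII, Thm 1 p.355 + p.391; Balaban1988Convergent, Thm 1 p.262; Theorem p.245; Balaban1989LargeFieldI, (0.3) p.176, p.177 (i)–(ii)] -/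
theorem thm1Printed_datumOfRecord₁₃_theta13LiveOfRecord_of_lawsLive {γ : ℝ} (hγ : 0 < γ)
    (hT : ∀ P : B12.RunParams, ((datumOfRecord₁₃ F N (theta13LiveOfRecord F N) h).C P).flow.InInterval γ P.K → ∀ k, k < P.K →
      SLaw₁₃ F N (theta13LiveOfRecord F N) P k →
      ∃ (t : SeqOfRecord F (theta13LiveOfRecord F N).ν (theta13LiveOfRecord F N).τ9.M (gOfRecord₁₃ F N (theta13LiveOfRecord F N) P) P.K (k + 1) →
          Sect2.TermValues (F.P P.K) (MatA N) (FluctV N) (theta13LiveOfRecord F N).τ9.M)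
      (Ek : SeqOfRecord F (theta13LiveOfRecord F N).ν (theta13LiveOfRecord F N).τ9.M (gOfRecord₁₃ F N (theta13LiveOfRecord F N) P) P.K (k + 1) → ℝ),
      Sect2.UniversalE t ∧
      ∀ s, Sect2.LawsT (sect2TowerOfRecord F N (FluctV N) P.K (settingOfRecord₁₃ F N (theta13LiveOfRecord F N) P) ((theta13LiveOfRecord F N).Rz P.K) s (t s))
          (settingOfRecord₁₃ F N (theta13LiveOfRecord F N) P).lf (settingOfRecord₁₃ F N (theta13LiveOfRecord F N) P).βc k ∧
        (LiveSeq F N (theta13LiveOfRecord F N).ν (theta13LiveOfRecord F N).τ9 P (gOfRecord₁₃ F N (theta13LiveOfRecord F N) P) (k + 1)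
            (slotsTOfRecord F N (theta13LiveOfRecord F N).ν (theta13LiveOfRecord F N).τ9 (EOfRecord₁₃ F N (theta13LiveOfRecord F N))
              (wOfRecord₉ F N (theta13LiveOfRecord F N).toStage9Params) (theta13LiveOfRecord F N).ppSel P
              (gOfRecord₁₃ F N (theta13LiveOfRecord F N) P) (k + 1)) s →
          (slotsTOfRecord F N (theta13LiveOfRecord F N).ν (theta13LiveOfRecord F N).τ9 (EOfRecord₁₃ F N (theta13LiveOfRecord F N))
              (wOfRecord₉ F N (theta13LiveOfRecord F N).toStage9Params) (theta13LiveOfRecord F N).ppSel P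
              (gOfRecord₁₃ F N (theta13LiveOfRecord F N) P) (k + 1) s = 0 ∨
            ∀ᵐ V ∂(fieldMeasure (F.P P.K) (k + 1) (SU N)),
              chiSeqOfRecord F N (theta13LiveOfRecord F N).ν (theta13LiveOfRecord F N).τ9.M (gOfRecord₁₃ F N (theta13LiveOfRecord F N) P) P.K (k + 1) s V ≠ 0 →
              slotsTOfRecord F N (theta13LiveOfRecord F N).ν (theta13LiveOfRecord F N).τ9 (EOfRecord₁₃ F N (theta13LiveOfRecord F N))
                  (wOfRecord₉ F N (theta13LiveOfRecord F N).toStage9Params) (theta13LiveOfRecord F N).ppSel P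
                  (gOfRecord₁₃ F N (theta13LiveOfRecord F N) P) (k + 1) s V
                = sect2Slot F N (FluctV N) P.K (settingOfRecord₁₃ F N (theta13LiveOfRecord F N) P) ((theta13LiveOfRecord F N).Rz P.K)
                    (WtOfRecord₁₃ F N (theta13LiveOfRecord F N) P) s (t s) (Ek s) (UbgOfRecord₁₃ F N (theta13LiveOfRecord F N) P (k + 1) s) V))) :
    B16.Thm1Printed (datumOfRecord₁₃ F N (theta13LiveOfRecord F N) h).C :=
  thm1Printed_datumOfRecord₁₃_of_lawsLive_of_liveSel F N (theta13LiveOfRecord F N) h (admissible_theta13LiveOfRecord F N)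
    (kappa_nonneg_theta13LiveOfFamily F N _ _ _ _) (E0_nonneg_theta13LiveOfFamily F N _ _ _ _) (B0_nonneg_theta13LiveOfFamily F N _ _ _ _)
    (liveRepin₁₃_liveSel F N (theta13OfFamily F N eps0OfRecord₁₃ _ _ _)) hγ hT

/-- **★★ THE (B)-FACE's FIRST CONJUNCT AT THE WITNESS OF RECORD FROM ROW P11 `bg` + THE FULL (S1ᵀ) along the windowed runs** — everything else (admissibility, signs,
the other `Provisos₁₃` fields, the 𝐑-leaf) is a theorem at the witness.  A REDUCTION, not a discharge: both hypotheses are Bałaban's analysis ([III] (2.7) +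
[15] Thm 1; [III] Sects. 1–3). [cite: Balaban1989LargeFieldII, Thm 1 p.355; Balaban1988Convergent, Thm 1 p.262, Theorem p.245, (2.7) p.255, (2.28) p.259] -/
theorem thm1Printed_datumOfRecord₁₃_theta13LiveOfRecord_of_bg_of_laws
    (hbg : ∀ (p : B12.RunParams) (n : ℕ), n ≤ p.K → Step.InInterval (theta13LiveOfRecord F N).γ n (gOfRecord₁₃ F N (theta13LiveOfRecord F N) p) →
      BgProvisoΛ F N p.K (settingOfRecord₁₃ F N (theta13LiveOfRecord F N) p) ((theta13LiveOfRecord F N).Rz p.K) (theta13LiveOfRecord F N).τ9.M n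
        (suppOfRecord₁₃ F N (theta13LiveOfRecord F N) p n) (UbgOfRecord₁₃ F N (theta13LiveOfRecord F N) p n))
    {γ : ℝ} (hγ : 0 < γ)
    (hT : ∀ P : B12.RunParams,
      ((datumOfRecord₁₃ F N (theta13LiveOfRecord F N) (provisos₁₃_theta13LiveOfRecord_of_bg F N hbg)).C P).flow.InInterval γ P.K →
      ∀ k, k < P.K → SLaw₁₃ F N (theta13LiveOfRecord F N) P k → TLaw₁₃ F N (theta13LiveOfRecord F N) P k) :
    B16.Thm1Printed (datumOfRecord₁₃ F N (theta13LiveOfRecord F N) (provisos₁₃_theta13LiveOfRecord_of_bg F N hbg)).C :=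
  thm1Printed_datumOfRecord₁₃_theta13LiveOfRecord_of_laws F N (provisos₁₃_theta13LiveOfRecord_of_bg F N hbg) hγ hT

end OfRecord

/-! ## §4  At node00-def-K0a's OPEN-LETTER family `θ₁₃(ε₀, ε₂₉) = theta13LiveOfFamily₂ F N ε₀ ε₂₉ ζ Rz Zt` (FILE 9): admissibility and signs DISCHARGED -/

section Family₂

variable (ε₀ ε₂₉ : ℝ) (ζ : ZetaOfRecord F N (numerics7OfFamily ε₀) 1) (Rz : (K : ℕ) → Sect2.Residual (F.P K) (MatA N))
  (Zt : (K : ℕ) → TkResidualW F N (FluctV N) K) (p : B12.RunParams)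

/-- `θ₁₃(ε₀, ε₂₉)`'s decay rate is `κ = 2·10⁴ ≥ 0`. [cite: Balaban1987RG1, (1.18) p.263 (bookkeeping witness)] -/
theorem kappa_nonneg_theta13LiveOfFamily₂ : 0 ≤ (theta13LiveOfFamily₂ F N ε₀ ε₂₉ ζ Rz Zt).s2.lf.κ := by
  rw [theta13LiveOfFamily₂_κ]; norm_num

/-- `θ₁₃(ε₀, ε₂₉)`'s term constants have `E₀ = 1 ≥ 0`. [cite: Balaban1988Convergent, (2.31) p.260 (bookkeeping witness)] -/
theorem E0_nonneg_theta13LiveOfFamily₂ : 0 ≤ (theta13LiveOfFamily₂ F N ε₀ ε₂₉ ζ Rz Zt).s2.lf.E₀ := by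
  have hE : (theta13LiveOfFamily₂ F N ε₀ ε₂₉ ζ Rz Zt).s2.lf.E₀ = 1 := rfl
  rw [hE]; exact zero_le_one

/-- `θ₁₃(ε₀, ε₂₉)`'s term constants have `B₀ = 1 ≥ 0`. [cite: Balaban1988Convergent, (2.42) p.261 (bookkeeping witness)] -/
theorem B0_nonneg_theta13LiveOfFamily₂ : 0 ≤ (theta13LiveOfFamily₂ F N ε₀ ε₂₉ ζ Rz Zt).s2.lf.B₀ := by
  have hB : (theta13LiveOfFamily₂ F N ε₀ ε₂₉ ζ Rz Zt).s2.lf.B₀ = 1 := rfl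
  rw [hB]; exact zero_le_one

variable {ε₀ ε₂₉}

/-- **★ THE 𝐑-LEAF OF RECORD AT THE OPEN-LETTER FAMILY WITNESS FROM THE PROVISOS ALONE** (`0 < ε₀`, `0 < ε₂₉`).
[cite: Balaban1988Convergent, p.244, Thm 2 p.263; Balaban1989LargeFieldI, (0.3) p.176, p.177 (i)–(ii); Balaban1989LargeFieldII, Thm 1 p.355 (not exercised)] -/
theorem rOpLeaf_VOfRecord₁₃_theta13LiveOfFamily₂_of_provisos (hε : 0 < ε₀) (hε' : 0 < ε₂₉)
    (h : (theta13LiveOfFamily₂ F N ε₀ ε₂₉ ζ Rz Zt).Provisos₁₃ F N) :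
    ROpLeaf (VOfRecord₁₃ F N (theta13LiveOfFamily₂ F N ε₀ ε₂₉ ζ Rz Zt) p) :=
  rOpLeaf_VOfRecord₁₃_liveRepin₁₃ F N (theta13OfFamily₂ F N ε₀ ε₂₉ ζ Rz Zt) p h (admissible_theta13OfFamily₂ F N ζ Rz Zt hε hε')
    (kappa_nonneg_theta13LiveOfFamily₂ F N ε₀ ε₂₉ ζ Rz Zt) (E0_nonneg_theta13LiveOfFamily₂ F N ε₀ ε₂₉ ζ Rz Zt)
    (B0_nonneg_theta13LiveOfFamily₂ F N ε₀ ε₂₉ ζ Rz Zt)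

/-- **The (R₁₃) slot in law form at the open-letter family witness, from the provisos alone.** [cite: Balaban1988Convergent, p.244 (bookkeeping); Balaban1989LargeFieldII, Thm 1 p.355 (not exercised)] -/
theorem laws₁₃_theta13LiveOfFamily₂_of_provisos (hε : 0 < ε₀) (hε' : 0 < ε₂₉) (h : (theta13LiveOfFamily₂ F N ε₀ ε₂₉ ζ Rz Zt).Provisos₁₃ F N) :
    ∀ k, k < p.K → TLaw₁₃ F N (theta13LiveOfFamily₂ F N ε₀ ε₂₉ ζ Rz Zt) p k → SLaw₁₃ F N (theta13LiveOfFamily₂ F N ε₀ ε₂₉ ζ Rz Zt) p (k + 1) :=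
  (rOpLeaf_VOfRecord₁₃_iff F N _ p).mp (rOpLeaf_VOfRecord₁₃_theta13LiveOfFamily₂_of_provisos F N ζ Rz Zt p hε hε' h)

/-- **`ρ_{k+1} = 𝐓ρ_k` a.e. at the open-letter family witness**, `k < K`. [cite: Balaban1989LargeFieldI, (0.2)–(0.4) p.176, p.177 (i)–(ii); Balaban1988Convergent, (3.24)–(3.25) p.270] -/
theorem densOfRecord₁₃_succ_ae_eq_tdens_theta13LiveOfFamily₂ (h : (theta13LiveOfFamily₂ F N ε₀ ε₂₉ ζ Rz Zt).Provisos₁₃ F N) (k : ℕ) (hk : k < p.K) :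
    densOfRecord₁₃ F N (theta13LiveOfFamily₂ F N ε₀ ε₂₉ ζ Rz Zt) p (k + 1) =ᵐ[fieldMeasure (F.P p.K) (k + 1) (SU N)]
      tdensOfRecord₁₃ F N (theta13LiveOfFamily₂ F N ε₀ ε₂₉ ζ Rz Zt) p k :=
  densOfRecord₁₃_succ_ae_eq_tdens_liveRepin₁₃ F N (theta13OfFamily₂ F N ε₀ ε₂₉ ζ Rz Zt) p h k hk

variable (h : (theta13LiveOfFamily₂ F N ε₀ ε₂₉ ζ Rz Zt).Provisos₁₃ F N)

/-- **★ THE (B)-FACE's FIRST CONJUNCT AT THE OPEN-LETTER FAMILY WITNESS FROM THE FULL (S1ᵀ) along the windowed runs** (`0 < ε₀`, `0 < ε₂₉`, `0 < γ`).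
[cite: Balaban1989LargeFieldII, Thm 1 p.355; Balaban1988Convergent, Thm 1 p.262; Theorem p.245; p.244] -/
theorem thm1Printed_datumOfRecord₁₃_theta13LiveOfFamily₂_of_laws (hε : 0 < ε₀) (hε' : 0 < ε₂₉) {γ : ℝ} (hγ : 0 < γ)
    (hT : ∀ P : B12.RunParams, ((datumOfRecord₁₃ F N (theta13LiveOfFamily₂ F N ε₀ ε₂₉ ζ Rz Zt) h).C P).flow.InInterval γ P.K →
      ∀ k, k < P.K → SLaw₁₃ F N (theta13LiveOfFamily₂ F N ε₀ ε₂₉ ζ Rz Zt) P k → TLaw₁₃ F N (theta13LiveOfFamily₂ F N ε₀ ε₂₉ ζ Rz Zt) P k) :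
    B16.Thm1Printed (datumOfRecord₁₃ F N (theta13LiveOfFamily₂ F N ε₀ ε₂₉ ζ Rz Zt) h).C :=
  thm1Printed_datumOfRecord₁₃_liveRepin₁₃_of_laws F N (theta13OfFamily₂ F N ε₀ ε₂₉ ζ Rz Zt) h (admissible_theta13OfFamily₂ F N ζ Rz Zt hε hε')
    (kappa_nonneg_theta13LiveOfFamily₂ F N ε₀ ε₂₉ ζ Rz Zt) (E0_nonneg_theta13LiveOfFamily₂ F N ε₀ ε₂₉ ζ Rz Zt)
    (B0_nonneg_theta13LiveOfFamily₂ F N ε₀ ε₂₉ ζ Rz Zt) hγ hT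

variable (w : WorldP)

/-- **N11 · `Dag.B14_main (leavesP w P)` AT A WORLD BOUND TO THE OPEN-LETTER FAMILY WITNESS's DATUM — ONE DISPLAYED SLOT (S1ᵀ)** (`0 < ε₀`, `0 < ε₂₉`).
[cite: Balaban1988Convergent, Thm 1 p.262; Theorem p.245; p.244; (2.6) p.255] -/
theorem b14_main_at_record₁₃_theta13LiveOfFamily₂ (hε : 0 < ε₀) (hε' : 0 < ε₂₉)
    (hC : w.C = (datumOfRecord₁₃ F N (theta13LiveOfFamily₂ F N ε₀ ε₂₉ ζ Rz Zt) h).C)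
    (hT : (leavesP w p).b7 → (leavesP w p).b8 → (leavesP w p).b9 → (leavesP w p).b10 → (leavesP w p).b11 →
      (leavesP w p).smallCouplings → (leavesP w p).smallFieldInductive → (leavesP w p).flowControl →
        ∀ k, k < p.K → SLaw₁₃ F N (theta13LiveOfFamily₂ F N ε₀ ε₂₉ ζ Rz Zt) p k → TLaw₁₃ F N (theta13LiveOfFamily₂ F N ε₀ ε₂₉ ζ Rz Zt) p k) :
    Dag.B14_main (leavesP w p) :=
  b14_main_at_record₁₃_liveRepin₁₃ F N (theta13OfFamily₂ F N ε₀ ε₂₉ ζ Rz Zt) p w h hC (admissible_theta13OfFamily₂ F N ζ Rz Zt hε hε')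
    (kappa_nonneg_theta13LiveOfFamily₂ F N ε₀ ε₂₉ ζ Rz Zt) (E0_nonneg_theta13LiveOfFamily₂ F N ε₀ ε₂₉ ζ Rz Zt)
    (B0_nonneg_theta13LiveOfFamily₂ F N ε₀ ε₂₉ ζ Rz Zt) hT

end Family₂

/-! ## §5  At node00-def-K0a's NUMERICS-GENERIC witness `θ₁₃(n) = theta13LiveOfNumerics F N n ε₂₉ ζ Rz Zt` (FILE 9 §3; every numeric letter a parameter — the
witness dag-lead WORDS-131 ∕ ref-D ⚑ EPS-PIN direct the small-row consumers to): `n.Pos`, `0 < ε₂₉` and the three term-constant signs of `n` displayed -/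

section Numerics

variable (n : Stage12Numerics) (ε₂₉ : ℝ) (ζ : ZetaOfRecord F N n.ν n.τ9.M) (Rz : (K : ℕ) → Sect2.Residual (F.P K) (MatA N))
  (Zt : (K : ℕ) → TkResidualW F N (FluctV N) K) (p : B12.RunParams)

variable {n ε₂₉}

/-- **★ THE 𝐑-LEAF OF RECORD AT THE NUMERICS-GENERIC WITNESS FROM THE PROVISOS ALONE** (`n.Pos`, `0 < ε₂₉`, `0 ≤ κ, E₀, B₀` of `n` displayed).
[cite: Balaban1988Convergent, p.244, Thm 2 p.263; Balaban1989LargeFieldI, (0.3) p.176, p.177 (i)–(ii); Balaban1989LargeFieldII, Thm 1 p.355 (not exercised)] -/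
theorem rOpLeaf_VOfRecord₁₃_theta13LiveOfNumerics_of_provisos (hn : n.Pos) (hε' : 0 < ε₂₉) (hκ : 0 ≤ n.s2.lf.κ) (hE₀ : 0 ≤ n.s2.lf.E₀)
    (hB₀ : 0 ≤ n.s2.lf.B₀) (h : (theta13LiveOfNumerics F N n ε₂₉ ζ Rz Zt).Provisos₁₃ F N) :
    ROpLeaf (VOfRecord₁₃ F N (theta13LiveOfNumerics F N n ε₂₉ ζ Rz Zt) p) :=
  rOpLeaf_VOfRecord₁₃_liveRepin₁₃ F N (theta13OfNumerics F N n ε₂₉ ζ Rz Zt) p h (admissible_theta13OfNumerics F N ζ Rz Zt hn hε') hκ hE₀ hB₀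

/-- **The (R₁₃) slot in law form at the numerics-generic witness, from the provisos alone.** [cite: Balaban1988Convergent, p.244 (bookkeeping); Balaban1989LargeFieldII, Thm 1 p.355 (not exercised)] -/
theorem laws₁₃_theta13LiveOfNumerics_of_provisos (hn : n.Pos) (hε' : 0 < ε₂₉) (hκ : 0 ≤ n.s2.lf.κ) (hE₀ : 0 ≤ n.s2.lf.E₀) (hB₀ : 0 ≤ n.s2.lf.B₀)
    (h : (theta13LiveOfNumerics F N n ε₂₉ ζ Rz Zt).Provisos₁₃ F N) :
    ∀ k, k < p.K → TLaw₁₃ F N (theta13LiveOfNumerics F N n ε₂₉ ζ Rz Zt) p k → SLaw₁₃ F N (theta13LiveOfNumerics F N n ε₂₉ ζ Rz Zt) p (k + 1) :=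
  (rOpLeaf_VOfRecord₁₃_iff F N _ p).mp (rOpLeaf_VOfRecord₁₃_theta13LiveOfNumerics_of_provisos F N ζ Rz Zt p hn hε' hκ hE₀ hB₀ h)

/-- **`ρ_{k+1} = 𝐓ρ_k` a.e. at the numerics-generic witness**, `k < K` (from `Provisos₁₃` there alone). [cite: Balaban1989LargeFieldI, (0.2)–(0.4) p.176, p.177 (i)–(ii); Balaban1988Convergent, (3.24)–(3.25) p.270] -/
theorem densOfRecord₁₃_succ_ae_eq_tdens_theta13LiveOfNumerics (h : (theta13LiveOfNumerics F N n ε₂₉ ζ Rz Zt).Provisos₁₃ F N) (k : ℕ) (hk : k < p.K) :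
    densOfRecord₁₃ F N (theta13LiveOfNumerics F N n ε₂₉ ζ Rz Zt) p (k + 1) =ᵐ[fieldMeasure (F.P p.K) (k + 1) (SU N)]
      tdensOfRecord₁₃ F N (theta13LiveOfNumerics F N n ε₂₉ ζ Rz Zt) p k :=
  densOfRecord₁₃_succ_ae_eq_tdens_liveRepin₁₃ F N (theta13OfNumerics F N n ε₂₉ ζ Rz Zt) p h k hk

variable (h : (theta13LiveOfNumerics F N n ε₂₉ ζ Rz Zt).Provisos₁₃ F N)

/-- **★ THE (B)-FACE's FIRST CONJUNCT AT THE NUMERICS-GENERIC WITNESS FROM THE FULL (S1ᵀ) along the windowed runs** (`0 < γ`; signs of `n` displayed).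
[cite: Balaban1989LargeFieldII, Thm 1 p.355; Balaban1988Convergent, Thm 1 p.262; Theorem p.245; p.244] -/
theorem thm1Printed_datumOfRecord₁₃_theta13LiveOfNumerics_of_laws (hn : n.Pos) (hε' : 0 < ε₂₉) (hκ : 0 ≤ n.s2.lf.κ) (hE₀ : 0 ≤ n.s2.lf.E₀)
    (hB₀ : 0 ≤ n.s2.lf.B₀) {γ : ℝ} (hγ : 0 < γ)
    (hT : ∀ P : B12.RunParams, ((datumOfRecord₁₃ F N (theta13LiveOfNumerics F N n ε₂₉ ζ Rz Zt) h).C P).flow.InInterval γ P.K →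
      ∀ k, k < P.K → SLaw₁₃ F N (theta13LiveOfNumerics F N n ε₂₉ ζ Rz Zt) P k → TLaw₁₃ F N (theta13LiveOfNumerics F N n ε₂₉ ζ Rz Zt) P k) :
    B16.Thm1Printed (datumOfRecord₁₃ F N (theta13LiveOfNumerics F N n ε₂₉ ζ Rz Zt) h).C :=
  thm1Printed_datumOfRecord₁₃_liveRepin₁₃_of_laws F N (theta13OfNumerics F N n ε₂₉ ζ Rz Zt) h (admissible_theta13OfNumerics F N ζ Rz Zt hn hε')
    hκ hE₀ hB₀ hγ hT

variable (w : WorldP)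

/-- **N11 · `Dag.B14_main (leavesP w P)` AT A WORLD BOUND TO THE NUMERICS-GENERIC WITNESS's DATUM — ONE DISPLAYED SLOT (S1ᵀ)** (+ `n.Pos`, `0 < ε₂₉`, signs).
[cite: Balaban1988Convergent, Thm 1 p.262; Theorem p.245; p.244; (2.6) p.255] -/
theorem b14_main_at_record₁₃_theta13LiveOfNumerics (hn : n.Pos) (hε' : 0 < ε₂₉) (hκ : 0 ≤ n.s2.lf.κ) (hE₀ : 0 ≤ n.s2.lf.E₀) (hB₀ : 0 ≤ n.s2.lf.B₀)
    (hC : w.C = (datumOfRecord₁₃ F N (theta13LiveOfNumerics F N n ε₂₉ ζ Rz Zt) h).C)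
    (hT : (leavesP w p).b7 → (leavesP w p).b8 → (leavesP w p).b9 → (leavesP w p).b10 → (leavesP w p).b11 →
      (leavesP w p).smallCouplings → (leavesP w p).smallFieldInductive → (leavesP w p).flowControl →
        ∀ k, k < p.K → SLaw₁₃ F N (theta13LiveOfNumerics F N n ε₂₉ ζ Rz Zt) p k → TLaw₁₃ F N (theta13LiveOfNumerics F N n ε₂₉ ζ Rz Zt) p k) :
    Dag.B14_main (leavesP w p) :=
  b14_main_at_record₁₃_liveRepin₁₃ F N (theta13OfNumerics F N n ε₂₉ ζ Rz Zt) p w h hC (admissible_theta13OfNumerics F N ζ Rz Zt hn hε') hκ hE₀ hB₀ hT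

end Numerics

section NumericsOfRecordResiduals

variable {n : Stage12Numerics} {ε₂₉ : ℝ} (p : B12.RunParams)

/-- **★★ THE 𝐑-LEAF OF RECORD AT THE NUMERICS-GENERIC WITNESS (K0b's residuals) FROM ROW P11 `bg` THERE ALONE** (K0a's socket
`provisos₁₃_theta13LiveOfNumerics_of_bg`; `n.Pos`, `0 < ε₂₉`, the three signs of `n` displayed): the shape in which seat node00-def-P11's numerics-carrying supplier
`Stage13Params.bg_of_thm1Scaled` («[15]-fact → bg at θ(n(B₃, a₀, a₁))») meets N13's conjunct on the witness line.  A REDUCTION, not a discharge.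
[cite: Balaban1988Convergent, p.244, (2.7) p.255, (2.28) p.259, Thm 2 p.263; Balaban1989LargeFieldI, (0.3) p.176, p.177 (i)–(ii); Balaban1989LargeFieldII, Thm 1 p.355 (not exercised)] -/
theorem rOpLeaf_VOfRecord₁₃_theta13LiveOfNumerics_of_bg (hn : n.Pos) (hε' : 0 < ε₂₉) (hκ : 0 ≤ n.s2.lf.κ) (hE₀ : 0 ≤ n.s2.lf.E₀)
    (hB₀ : 0 ≤ n.s2.lf.B₀)
    (hbg : ∀ (p : B12.RunParams) (m : ℕ), m ≤ p.K →
      Step.InInterval (theta13OfNumerics F N n ε₂₉ (zeta316OfRecord F N n.ν n.τ9.M n.A₁) (RzOfRecord F N) (ZtOfRecord F N)).γ m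
        (gOfRecord₁₃ F N (theta13OfNumerics F N n ε₂₉ (zeta316OfRecord F N n.ν n.τ9.M n.A₁) (RzOfRecord F N) (ZtOfRecord F N)) p) →
      BgProvisoΛ F N p.K
        (settingOfRecord₁₃ F N (theta13LiveOfNumerics F N n ε₂₉ (zeta316OfRecord F N n.ν n.τ9.M n.A₁) (RzOfRecord F N) (ZtOfRecord F N)) p)
        (RzOfRecord F N p.K) n.τ9.M m
        (suppOfRecord₁₃ F N (theta13LiveOfNumerics F N n ε₂₉ (zeta316OfRecord F N n.ν n.τ9.M n.A₁) (RzOfRecord F N) (ZtOfRecord F N)) p m)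
        (UbgOfRecord₁₃ F N (theta13LiveOfNumerics F N n ε₂₉ (zeta316OfRecord F N n.ν n.τ9.M n.A₁) (RzOfRecord F N) (ZtOfRecord F N)) p m)) :
    ROpLeaf (VOfRecord₁₃ F N (theta13LiveOfNumerics F N n ε₂₉ (zeta316OfRecord F N n.ν n.τ9.M n.A₁) (RzOfRecord F N) (ZtOfRecord F N)) p) :=
  rOpLeaf_VOfRecord₁₃_theta13LiveOfNumerics_of_provisos F N _ _ _ p hn hε' hκ hE₀ hB₀ (provisos₁₃_theta13LiveOfNumerics_of_bg F N n ε₂₉ hbg)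

end NumericsOfRecordResiduals

/-! ## §6  (v1.1) ★★ THE THREE DESKS' JUNCTION: at any live re-pin carrying K0b's residuals, N13's 𝐑-leaf — and `Provisos₁₃` itself — from seat node00-def-P11's
ROW-P11 SUPPLIER HYPOTHESES alone ([15] Thm 1 named fact + numerics clauses + the two gauge clauses), through node00-def-K0a's sockets -/

section ThreeDesks

open B15DeterminingSets B12RegularSpaces111 B14RegularSpaces234

variable (θ : Stage13Params F N) (p : B12.RunParams)

/-- **★ `Provisos₁₃` AT THE LIVE RE-PIN OF A PARAMETER CARRYING K0b's RESIDUALS FROM def-P11's ROW-P11 SUPPLIER HYPOTHESES ALONE** (K0‴'s residual in the P11 pen's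
currency): admissibility, `θ.HasResidualsOfRecord`, the named fact `VariationalThm1Scaled F N B₃ a₀ a₁` ([15] Thm 1 (8), per-scale reading), `εreg ≤ a₀`, the numerics
clauses `hnum` ∕ `hBα` along every windowed run, and the two gauge clauses `hloc` ((1.12) on the cubes of `X ⊆ Λ_j(s)`) ∕ `h238` ((2.38) on the (2.41) range) at the
minimiser of record — `Stage13Params.bg_of_thm1Scaled` (def-P11) ∘ `bg_liveRepin₁₃_iff` ∘ `provisos₁₃_liveRepin₁₃_of_bg` (K0a; (H-U) = K0c's `localBgMeasurable`).
A REDUCTION; nothing of Bałaban asserted. [cite: Balaban1988Convergent, (2.7) p.255, (2.12) p.256, (2.18) p.257, (2.27)–(2.28) p.259, (2.34)–(2.41) p.261, (3.16) p.268, (3.22) p.269; Balaban1985Variational, Thm 1 (8)–(10) p.279; Balaban1987RG1, (1.11)–(1.16) p.262; Balaban1989LargeFieldI, (0.3)–(0.4) p.176] -/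
theorem provisos₁₃_liveRepin₁₃_of_thm1Scaled (hθ : θ.Admissible F N) (hres : θ.HasResidualsOfRecord F N)
    {B₃ a₀ a₁ : ℝ} (h15 : VariationalThm1Scaled F N B₃ a₀ a₁) (ha₀ : θ.ν.εreg ≤ a₀)
    (hnum : ∀ (p : B12.RunParams) (n : ℕ), n ≤ p.K → Step.InInterval θ.γ n (gOfRecord₁₃ F N θ p) → ∀ m, m ≤ n →
      0 < θ.s2.cR * epsOfRecord θ.ν (gOfRecord₁₃ F N θ p) m ∧ θ.s2.cR * epsOfRecord θ.ν (gOfRecord₁₃ F N θ p) m ≤ a₁ ∧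
        B₃ * (θ.s2.cR * epsOfRecord θ.ν (gOfRecord₁₃ F N θ p) m) ≤ θ.ν.εreg)
    (hBα : ∀ (p : B12.RunParams) (n : ℕ), n ≤ p.K → Step.InInterval θ.γ n (gOfRecord₁₃ F N θ p) → ∀ m, 1 ≤ m → m ≤ n →
      B₃ * (θ.s2.cR * epsOfRecord θ.ν (gOfRecord₁₃ F N θ p) m) ≤ (1 - θ.s2.βc) * (lfOfRecord₁₂ F N θ.toStage12Params).alpha0 (gOfRecord₁₃ F N θ p m))
    (hloc : ∀ (p : B12.RunParams) (n : ℕ), n ≤ p.K → Step.InInterval θ.γ n (gOfRecord₁₃ F N θ p) →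
      ∀ (s : SeqOfRecord F θ.ν θ.τ9.M (gOfRecord₁₃ F N θ p) p.K n) (W : MSField (F.P p.K) (SU N)), W ∈ suppOfRecord₁₃ F N θ p n s →
      W ∈ solvableDom (avOfRecord F N p.K) (regMSOfRecord F N θ.ν p.K n s.Ω) (genSet s.Ω n) →
      ∀ j, 1 ≤ j → j ≤ n → ∀ X : (Sect2.domSys (F.P p.K) θ.τ9.M j).Dom, Sect2.domSites (F.P p.K) θ.τ9.M j X ⊆ s.Λ j →
      ∀ C ∈ Sect2.cubesI θ.τ9.M j (Sect2.domSites (F.P p.K) θ.τ9.M j X), ∃ u : Site (F.P p.K) 0 → (MatA N)ˣ,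
        (∀ x, u x ∈ (B12RegularSpaces111SpecialUnitary.suModel N).G) ∧ ∃ A : PBond (F.P p.K) 0 → MatA N,
        (∀ bd ∈ C.bonds, gaugeU u (fun b' => ιSU N (UbgMSOfRecord F N θ.ν θ.τ9.M (gOfRecord₁₃ F N θ p) p.K n s W b')) bd = expI ((F.P p.K).eta j) (A bd)) ∧
        (∀ bd ∈ C.bonds, ‖A bd‖ < θ.s2.cB * (lfOfRecord₁₂ F N θ.toStage12Params).alpha0 (gOfRecord₁₃ F N θ p j)) ∧
        ∀ q ∈ C.dpairs, ‖grad ((F.P p.K).eta j) q.2.1 (fun y => A ⟨y, q.2.2⟩) q.1‖ < θ.s2.cB * (lfOfRecord₁₂ F N θ.toStage12Params).alpha0 (gOfRecord₁₃ F N θ p j))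
    (h238 : ∀ (p : B12.RunParams) (n : ℕ), n ≤ p.K → Step.InInterval θ.γ n (gOfRecord₁₃ F N θ p) →
      ∀ (s : SeqOfRecord F θ.ν θ.τ9.M (gOfRecord₁₃ F N θ p) p.K n) (W : MSField (F.P p.K) (SU N)), W ∈ suppOfRecord₁₃ F N θ p n s →
      W ∈ solvableDom (avOfRecord F N p.K) (regMSOfRecord F N θ.ν p.K n s.Ω) (genSet s.Ω n) →
      ∀ j, 1 ≤ j → j ≤ n → ∀ X : (Sect2.domSys (F.P p.K) θ.τ9.M j).Dom,
      Sect2.admB (F.P p.K) θ.ν θ.τ9.M (gOfRecord₁₃ F N θ p) s.Ω s.Λ j (Sect2.domSites (F.P p.K) θ.τ9.M j X) = true →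
      CondII238 (B12RegularSpaces111SpecialUnitary.suModel N) (Sect2.frameMS (Sect2.Residual.unit (F.P p.K) (MatA N)) θ.τ9.M j (Sect2.domSites (F.P p.K) θ.τ9.M j X) s.Ω)
        (MSConsts.ofParams (F.P p.K) θ.s2.βc θ.s2.B θ.s2.C θ.s2.Mr j) (fun m => (lfOfRecord₁₂ F N θ.toStage12Params).alpha0 (gOfRecord₁₃ F N θ p m))
        (fun b' => ιSU N (UbgMSOfRecord F N θ.ν θ.τ9.M (gOfRecord₁₃ F N θ p) p.K n s W b'))) :
    (θ.liveRepin₁₃ F N).Provisos₁₃ F N :=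
  θ.provisos₁₃_liveRepin₁₃_of_bg hres ((θ.bg_liveRepin₁₃_iff F N).2 (θ.bg_of_thm1Scaled hθ hres.Rz_eq h15 ha₀ hnum hBα hloc h238))

/-- **★★ N13's 𝐑-LEAF AT THE LIVE RE-PIN OF A PARAMETER CARRYING K0b's RESIDUALS FROM def-P11's ROW-P11 SUPPLIER HYPOTHESES** (+ admissibility and the three
term-constant signs of `θ`) — the junction of the three desks (node00-def-P11's supplier, node00-def-K0a's sockets, this seat's leaf) in one kernel line: on the live
line the (R) conjunct of [B16] Thm 1 at the objects of record COSTS EXACTLY [15] Thm 1 (named fact (8) + the displayed (9)–(10) gauge clauses) and the numerics clauses of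
the family.  A REDUCTION, not a discharge. [cite: Balaban1988Convergent, p.244, (2.7) p.255, (2.28) p.259, Thm 2 p.263; Balaban1985Variational, Thm 1 (8)–(10) p.279; Balaban1989LargeFieldI, (0.3) p.176, p.177 (i)–(ii); Balaban1989LargeFieldII, Thm 1 p.355 (not exercised)] -/
theorem rOpLeaf_VOfRecord₁₃_liveRepin₁₃_of_thm1Scaled (hθ : θ.Admissible F N) (hres : θ.HasResidualsOfRecord F N) (hκ : 0 ≤ θ.s2.lf.κ)
    (hE₀ : 0 ≤ θ.s2.lf.E₀) (hB₀ : 0 ≤ θ.s2.lf.B₀)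
    {B₃ a₀ a₁ : ℝ} (h15 : VariationalThm1Scaled F N B₃ a₀ a₁) (ha₀ : θ.ν.εreg ≤ a₀)
    (hnum : ∀ (p : B12.RunParams) (n : ℕ), n ≤ p.K → Step.InInterval θ.γ n (gOfRecord₁₃ F N θ p) → ∀ m, m ≤ n →
      0 < θ.s2.cR * epsOfRecord θ.ν (gOfRecord₁₃ F N θ p) m ∧ θ.s2.cR * epsOfRecord θ.ν (gOfRecord₁₃ F N θ p) m ≤ a₁ ∧
        B₃ * (θ.s2.cR * epsOfRecord θ.ν (gOfRecord₁₃ F N θ p) m) ≤ θ.ν.εreg)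
    (hBα : ∀ (p : B12.RunParams) (n : ℕ), n ≤ p.K → Step.InInterval θ.γ n (gOfRecord₁₃ F N θ p) → ∀ m, 1 ≤ m → m ≤ n →
      B₃ * (θ.s2.cR * epsOfRecord θ.ν (gOfRecord₁₃ F N θ p) m) ≤ (1 - θ.s2.βc) * (lfOfRecord₁₂ F N θ.toStage12Params).alpha0 (gOfRecord₁₃ F N θ p m))
    (hloc : ∀ (p : B12.RunParams) (n : ℕ), n ≤ p.K → Step.InInterval θ.γ n (gOfRecord₁₃ F N θ p) →
      ∀ (s : SeqOfRecord F θ.ν θ.τ9.M (gOfRecord₁₃ F N θ p) p.K n) (W : MSField (F.P p.K) (SU N)), W ∈ suppOfRecord₁₃ F N θ p n s →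
      W ∈ solvableDom (avOfRecord F N p.K) (regMSOfRecord F N θ.ν p.K n s.Ω) (genSet s.Ω n) →
      ∀ j, 1 ≤ j → j ≤ n → ∀ X : (Sect2.domSys (F.P p.K) θ.τ9.M j).Dom, Sect2.domSites (F.P p.K) θ.τ9.M j X ⊆ s.Λ j →
      ∀ C ∈ Sect2.cubesI θ.τ9.M j (Sect2.domSites (F.P p.K) θ.τ9.M j X), ∃ u : Site (F.P p.K) 0 → (MatA N)ˣ,
        (∀ x, u x ∈ (B12RegularSpaces111SpecialUnitary.suModel N).G) ∧ ∃ A : PBond (F.P p.K) 0 → MatA N,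
        (∀ bd ∈ C.bonds, gaugeU u (fun b' => ιSU N (UbgMSOfRecord F N θ.ν θ.τ9.M (gOfRecord₁₃ F N θ p) p.K n s W b')) bd = expI ((F.P p.K).eta j) (A bd)) ∧
        (∀ bd ∈ C.bonds, ‖A bd‖ < θ.s2.cB * (lfOfRecord₁₂ F N θ.toStage12Params).alpha0 (gOfRecord₁₃ F N θ p j)) ∧
        ∀ q ∈ C.dpairs, ‖grad ((F.P p.K).eta j) q.2.1 (fun y => A ⟨y, q.2.2⟩) q.1‖ < θ.s2.cB * (lfOfRecord₁₂ F N θ.toStage12Params).alpha0 (gOfRecord₁₃ F N θ p j))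
    (h238 : ∀ (p : B12.RunParams) (n : ℕ), n ≤ p.K → Step.InInterval θ.γ n (gOfRecord₁₃ F N θ p) →
      ∀ (s : SeqOfRecord F θ.ν θ.τ9.M (gOfRecord₁₃ F N θ p) p.K n) (W : MSField (F.P p.K) (SU N)), W ∈ suppOfRecord₁₃ F N θ p n s →
      W ∈ solvableDom (avOfRecord F N p.K) (regMSOfRecord F N θ.ν p.K n s.Ω) (genSet s.Ω n) →
      ∀ j, 1 ≤ j → j ≤ n → ∀ X : (Sect2.domSys (F.P p.K) θ.τ9.M j).Dom,
      Sect2.admB (F.P p.K) θ.ν θ.τ9.M (gOfRecord₁₃ F N θ p) s.Ω s.Λ j (Sect2.domSites (F.P p.K) θ.τ9.M j X) = true →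
      CondII238 (B12RegularSpaces111SpecialUnitary.suModel N) (Sect2.frameMS (Sect2.Residual.unit (F.P p.K) (MatA N)) θ.τ9.M j (Sect2.domSites (F.P p.K) θ.τ9.M j X) s.Ω)
        (MSConsts.ofParams (F.P p.K) θ.s2.βc θ.s2.B θ.s2.C θ.s2.Mr j) (fun m => (lfOfRecord₁₂ F N θ.toStage12Params).alpha0 (gOfRecord₁₃ F N θ p m))
        (fun b' => ιSU N (UbgMSOfRecord F N θ.ν θ.τ9.M (gOfRecord₁₃ F N θ p) p.K n s W b'))) :
    ROpLeaf (VOfRecord₁₃ F N (θ.liveRepin₁₃ F N) p) :=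
  rOpLeaf_VOfRecord₁₃_liveRepin₁₃ F N θ p (provisos₁₃_liveRepin₁₃_of_thm1Scaled F N θ hθ hres h15 ha₀ hnum hBα hloc h238) hθ hκ hE₀ hB₀

/-- **The (R₁₃) law slot at the live re-pin from def-P11's ROW-P11 supplier hypotheses** (law form of the previous theorem — the `hR13` ∕ `hR` slot of dag-n24-c's ∕
dag-n11-d's Stage-13 knits, supplied in the P11 pen's currency). [cite: Balaban1988Convergent, p.244 (bookkeeping); Balaban1985Variational, Thm 1 (8)–(10) p.279; Balaban1989LargeFieldII, Thm 1 p.355 (not exercised)] -/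
theorem laws₁₃_liveRepin₁₃_of_thm1Scaled (hθ : θ.Admissible F N) (hres : θ.HasResidualsOfRecord F N) (hκ : 0 ≤ θ.s2.lf.κ) (hE₀ : 0 ≤ θ.s2.lf.E₀)
    (hB₀ : 0 ≤ θ.s2.lf.B₀)
    {B₃ a₀ a₁ : ℝ} (h15 : VariationalThm1Scaled F N B₃ a₀ a₁) (ha₀ : θ.ν.εreg ≤ a₀)
    (hnum : ∀ (p : B12.RunParams) (n : ℕ), n ≤ p.K → Step.InInterval θ.γ n (gOfRecord₁₃ F N θ p) → ∀ m, m ≤ n →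
      0 < θ.s2.cR * epsOfRecord θ.ν (gOfRecord₁₃ F N θ p) m ∧ θ.s2.cR * epsOfRecord θ.ν (gOfRecord₁₃ F N θ p) m ≤ a₁ ∧
        B₃ * (θ.s2.cR * epsOfRecord θ.ν (gOfRecord₁₃ F N θ p) m) ≤ θ.ν.εreg)
    (hBα : ∀ (p : B12.RunParams) (n : ℕ), n ≤ p.K → Step.InInterval θ.γ n (gOfRecord₁₃ F N θ p) → ∀ m, 1 ≤ m → m ≤ n →
      B₃ * (θ.s2.cR * epsOfRecord θ.ν (gOfRecord₁₃ F N θ p) m) ≤ (1 - θ.s2.βc) * (lfOfRecord₁₂ F N θ.toStage12Params).alpha0 (gOfRecord₁₃ F N θ p m))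
    (hloc : ∀ (p : B12.RunParams) (n : ℕ), n ≤ p.K → Step.InInterval θ.γ n (gOfRecord₁₃ F N θ p) →
      ∀ (s : SeqOfRecord F θ.ν θ.τ9.M (gOfRecord₁₃ F N θ p) p.K n) (W : MSField (F.P p.K) (SU N)), W ∈ suppOfRecord₁₃ F N θ p n s →
      W ∈ solvableDom (avOfRecord F N p.K) (regMSOfRecord F N θ.ν p.K n s.Ω) (genSet s.Ω n) →
      ∀ j, 1 ≤ j → j ≤ n → ∀ X : (Sect2.domSys (F.P p.K) θ.τ9.M j).Dom, Sect2.domSites (F.P p.K) θ.τ9.M j X ⊆ s.Λ j →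
      ∀ C ∈ Sect2.cubesI θ.τ9.M j (Sect2.domSites (F.P p.K) θ.τ9.M j X), ∃ u : Site (F.P p.K) 0 → (MatA N)ˣ,
        (∀ x, u x ∈ (B12RegularSpaces111SpecialUnitary.suModel N).G) ∧ ∃ A : PBond (F.P p.K) 0 → MatA N,
        (∀ bd ∈ C.bonds, gaugeU u (fun b' => ιSU N (UbgMSOfRecord F N θ.ν θ.τ9.M (gOfRecord₁₃ F N θ p) p.K n s W b')) bd = expI ((F.P p.K).eta j) (A bd)) ∧
        (∀ bd ∈ C.bonds, ‖A bd‖ < θ.s2.cB * (lfOfRecord₁₂ F N θ.toStage12Params).alpha0 (gOfRecord₁₃ F N θ p j)) ∧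
        ∀ q ∈ C.dpairs, ‖grad ((F.P p.K).eta j) q.2.1 (fun y => A ⟨y, q.2.2⟩) q.1‖ < θ.s2.cB * (lfOfRecord₁₂ F N θ.toStage12Params).alpha0 (gOfRecord₁₃ F N θ p j))
    (h238 : ∀ (p : B12.RunParams) (n : ℕ), n ≤ p.K → Step.InInterval θ.γ n (gOfRecord₁₃ F N θ p) →
      ∀ (s : SeqOfRecord F θ.ν θ.τ9.M (gOfRecord₁₃ F N θ p) p.K n) (W : MSField (F.P p.K) (SU N)), W ∈ suppOfRecord₁₃ F N θ p n s →
      W ∈ solvableDom (avOfRecord F N p.K) (regMSOfRecord F N θ.ν p.K n s.Ω) (genSet s.Ω n) →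
      ∀ j, 1 ≤ j → j ≤ n → ∀ X : (Sect2.domSys (F.P p.K) θ.τ9.M j).Dom,
      Sect2.admB (F.P p.K) θ.ν θ.τ9.M (gOfRecord₁₃ F N θ p) s.Ω s.Λ j (Sect2.domSites (F.P p.K) θ.τ9.M j X) = true →
      CondII238 (B12RegularSpaces111SpecialUnitary.suModel N) (Sect2.frameMS (Sect2.Residual.unit (F.P p.K) (MatA N)) θ.τ9.M j (Sect2.domSites (F.P p.K) θ.τ9.M j X) s.Ω)
        (MSConsts.ofParams (F.P p.K) θ.s2.βc θ.s2.B θ.s2.C θ.s2.Mr j) (fun m => (lfOfRecord₁₂ F N θ.toStage12Params).alpha0 (gOfRecord₁₃ F N θ p m))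
        (fun b' => ιSU N (UbgMSOfRecord F N θ.ν θ.τ9.M (gOfRecord₁₃ F N θ p) p.K n s W b'))) :
    ∀ k, k < p.K → TLaw₁₃ F N (θ.liveRepin₁₃ F N) p k → SLaw₁₃ F N (θ.liveRepin₁₃ F N) p (k + 1) :=
  (rOpLeaf_VOfRecord₁₃_iff F N _ p).mp (rOpLeaf_VOfRecord₁₃_liveRepin₁₃_of_thm1Scaled F N θ p hθ hres hκ hE₀ hB₀ h15 ha₀ hnum hBα hloc h238)

end ThreeDesks

section ThreeDesksNumerics

open B15DeterminingSets B12RegularSpaces111 B14RegularSpaces234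

variable {n : Stage12Numerics} {ε₂₉ : ℝ} (p : B12.RunParams)

/-- **★★ N13's 𝐑-LEAF AT THE NUMERICS-GENERIC WITNESS `θ₁₃(n)` (K0b's residuals) FROM def-P11's ROW-P11 SUPPLIER HYPOTHESES** stated in the letters of `n` (`n.Pos`,
`0 < ε₂₉`, the three term-constant signs of `n` displayed) — §6 at `θ := theta13OfNumerics F N n ε₂₉ …` with `HasResidualsOfRecord` by node00-def-K0a's
`hasResidualsOfRecord_theta13OfNumerics`: the socket shape at which K0a's [15]-keyed witness `theta13OfThm1` (an instance) discharges `hnum` ∕ `hBα` ∕ the signs by its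
numerics lemmas.  A REDUCTION, not a discharge. [cite: Balaban1988Convergent, p.244, (2.7) p.255, (2.28) p.259, Thm 2 p.263; Balaban1985Variational, Thm 1 (8)–(10) p.279; Balaban1989LargeFieldI, (0.3) p.176, p.177 (i)–(ii); Balaban1989LargeFieldII, Thm 1 p.355 (not exercised)] -/
theorem rOpLeaf_VOfRecord₁₃_theta13LiveOfNumerics_of_thm1Scaled (hn : n.Pos) (hε' : 0 < ε₂₉) (hκ : 0 ≤ n.s2.lf.κ) (hE₀ : 0 ≤ n.s2.lf.E₀)
    (hB₀ : 0 ≤ n.s2.lf.B₀)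
    {B₃ a₀ a₁ : ℝ} (h15 : VariationalThm1Scaled F N B₃ a₀ a₁) (ha₀ : n.ν.εreg ≤ a₀)
    (hnum : ∀ (p : B12.RunParams) (m' : ℕ), m' ≤ p.K → Step.InInterval n.γ m' (gOfRecord₁₃ F N (theta13OfNumerics F N n ε₂₉ (zeta316OfRecord F N n.ν n.τ9.M n.A₁) (RzOfRecord F N) (ZtOfRecord F N)) p) → ∀ m, m ≤ m' →
      0 < n.s2.cR * epsOfRecord n.ν (gOfRecord₁₃ F N (theta13OfNumerics F N n ε₂₉ (zeta316OfRecord F N n.ν n.τ9.M n.A₁) (RzOfRecord F N) (ZtOfRecord F N)) p) m ∧ n.s2.cR * epsOfRecord n.ν (gOfRecord₁₃ F N (theta13OfNumerics F N n ε₂₉ (zeta316OfRecord F N n.ν n.τ9.M n.A₁) (RzOfRecord F N) (ZtOfRecord F N)) p) m ≤ a₁ ∧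
        B₃ * (n.s2.cR * epsOfRecord n.ν (gOfRecord₁₃ F N (theta13OfNumerics F N n ε₂₉ (zeta316OfRecord F N n.ν n.τ9.M n.A₁) (RzOfRecord F N) (ZtOfRecord F N)) p) m) ≤ n.ν.εreg)
    (hBα : ∀ (p : B12.RunParams) (m' : ℕ), m' ≤ p.K → Step.InInterval n.γ m' (gOfRecord₁₃ F N (theta13OfNumerics F N n ε₂₉ (zeta316OfRecord F N n.ν n.τ9.M n.A₁) (RzOfRecord F N) (ZtOfRecord F N)) p) → ∀ m, 1 ≤ m → m ≤ m' →
      B₃ * (n.s2.cR * epsOfRecord n.ν (gOfRecord₁₃ F N (theta13OfNumerics F N n ε₂₉ (zeta316OfRecord F N n.ν n.τ9.M n.A₁) (RzOfRecord F N) (ZtOfRecord F N)) p) m) ≤ (1 - n.s2.βc) * (lfOfRecord₁₂ F N (theta13OfNumerics F N n ε₂₉ (zeta316OfRecord F N n.ν n.τ9.M n.A₁) (RzOfRecord F N) (ZtOfRecord F N)).toStage12Params).alpha0 ((gOfRecord₁₃ F N (theta13OfNumerics F N n ε₂₉ (zeta316OfRecord F N n.ν n.τ9.M n.A₁) (RzOfRecord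 F N) (ZtOfRecord F N)) p) m))
    (hloc : ∀ (p : B12.RunParams) (m' : ℕ), m' ≤ p.K → Step.InInterval n.γ m' (gOfRecord₁₃ F N (theta13OfNumerics F N n ε₂₉ (zeta316OfRecord F N n.ν n.τ9.M n.A₁) (RzOfRecord F N) (ZtOfRecord F N)) p) →
      ∀ (s : SeqOfRecord F n.ν n.τ9.M (gOfRecord₁₃ F N (theta13OfNumerics F N n ε₂₉ (zeta316OfRecord F N n.ν n.τ9.M n.A₁) (RzOfRecord F N) (ZtOfRecord F N)) p) p.K m') (W : MSField (F.P p.K) (SU N)), W ∈ suppOfRecord₁₃ F N (theta13OfNumerics F N n ε₂₉ (zeta316OfRecord F N n.ν n.τ9.M n.A₁) (RzOfRecord F N) (ZtOfRecord F N)) p m' s →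
      W ∈ solvableDom (avOfRecord F N p.K) (regMSOfRecord F N n.ν p.K m' s.Ω) (genSet s.Ω m') →
      ∀ j, 1 ≤ j → j ≤ m' → ∀ X : (Sect2.domSys (F.P p.K) n.τ9.M j).Dom, Sect2.domSites (F.P p.K) n.τ9.M j X ⊆ s.Λ j →
      ∀ C ∈ Sect2.cubesI n.τ9.M j (Sect2.domSites (F.P p.K) n.τ9.M j X), ∃ u : Site (F.P p.K) 0 → (MatA N)ˣ,
        (∀ x, u x ∈ (B12RegularSpaces111SpecialUnitary.suModel N).G) ∧ ∃ A : PBond (F.P p.K) 0 → MatA N,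
        (∀ bd ∈ C.bonds, gaugeU u (fun b' => ιSU N (UbgMSOfRecord F N n.ν n.τ9.M (gOfRecord₁₃ F N (theta13OfNumerics F N n ε₂₉ (zeta316OfRecord F N n.ν n.τ9.M n.A₁) (RzOfRecord F N) (ZtOfRecord F N)) p) p.K m' s W b')) bd = expI ((F.P p.K).eta j) (A bd)) ∧
        (∀ bd ∈ C.bonds, ‖A bd‖ < n.s2.cB * (lfOfRecord₁₂ F N (theta13OfNumerics F N n ε₂₉ (zeta316OfRecord F N n.ν n.τ9.M n.A₁) (RzOfRecord F N) (ZtOfRecord F N)).toStage12Params).alpha0 ((gOfRecord₁₃ F N (theta13OfNumerics F N n ε₂₉ (zeta316OfRecord F N n.ν n.τ9.M n.A₁) (RzOfRecord F N) (ZtOfRecord F N)) p) j)) ∧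
        ∀ q ∈ C.dpairs, ‖grad ((F.P p.K).eta j) q.2.1 (fun y => A ⟨y, q.2.2⟩) q.1‖ < n.s2.cB * (lfOfRecord₁₂ F N (theta13OfNumerics F N n ε₂₉ (zeta316OfRecord F N n.ν n.τ9.M n.A₁) (RzOfRecord F N) (ZtOfRecord F N)).toStage12Params).alpha0 ((gOfRecord₁₃ F N (theta13OfNumerics F N n ε₂₉ (zeta316OfRecord F N n.ν n.τ9.M n.A₁) (RzOfRecord F N) (ZtOfRecord F N)) p) j))
    (h238 : ∀ (p : B12.RunParams) (m' : ℕ), m' ≤ p.K → Step.InInterval n.γ m' (gOfRecord₁₃ F N (theta13OfNumerics F N n ε₂₉ (zeta316OfRecord F N n.ν n.τ9.M n.A₁) (RzOfRecord F N) (ZtOfRecord F N)) p) →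
      ∀ (s : SeqOfRecord F n.ν n.τ9.M (gOfRecord₁₃ F N (theta13OfNumerics F N n ε₂₉ (zeta316OfRecord F N n.ν n.τ9.M n.A₁) (RzOfRecord F N) (ZtOfRecord F N)) p) p.K m') (W : MSField (F.P p.K) (SU N)), W ∈ suppOfRecord₁₃ F N (theta13OfNumerics F N n ε₂₉ (zeta316OfRecord F N n.ν n.τ9.M n.A₁) (RzOfRecord F N) (ZtOfRecord F N)) p m' s →
      W ∈ solvableDom (avOfRecord F N p.K) (regMSOfRecord F N n.ν p.K m' s.Ω) (genSet s.Ω m') →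
      ∀ j, 1 ≤ j → j ≤ m' → ∀ X : (Sect2.domSys (F.P p.K) n.τ9.M j).Dom,
      Sect2.admB (F.P p.K) n.ν n.τ9.M (gOfRecord₁₃ F N (theta13OfNumerics F N n ε₂₉ (zeta316OfRecord F N n.ν n.τ9.M n.A₁) (RzOfRecord F N) (ZtOfRecord F N)) p) s.Ω s.Λ j (Sect2.domSites (F.P p.K) n.τ9.M j X) = true →
      CondII238 (B12RegularSpaces111SpecialUnitary.suModel N) (Sect2.frameMS (Sect2.Residual.unit (F.P p.K) (MatA N)) n.τ9.M j (Sect2.domSites (F.P p.K) n.τ9.M j X) s.Ω)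
        (MSConsts.ofParams (F.P p.K) n.s2.βc n.s2.B n.s2.C n.s2.Mr j) (fun m => (lfOfRecord₁₂ F N (theta13OfNumerics F N n ε₂₉ (zeta316OfRecord F N n.ν n.τ9.M n.A₁) (RzOfRecord F N) (ZtOfRecord F N)).toStage12Params).alpha0 ((gOfRecord₁₃ F N (theta13OfNumerics F N n ε₂₉ (zeta316OfRecord F N n.ν n.τ9.M n.A₁) (RzOfRecord F N) (ZtOfRecord F N)) p) m))
        (fun b' => ιSU N (UbgMSOfRecord F N n.ν n.τ9.M (gOfRecord₁₃ F N (theta13OfNumerics F N n ε₂₉ (zeta316OfRecord F N n.ν n.τ9.M n.A₁) (RzOfRecord F N) (ZtOfRecord F N)) p) p.K m' s W b'))) :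
    ROpLeaf (VOfRecord₁₃ F N (theta13LiveOfNumerics F N n ε₂₉ (zeta316OfRecord F N n.ν n.τ9.M n.A₁) (RzOfRecord F N) (ZtOfRecord F N)) p) :=
  rOpLeaf_VOfRecord₁₃_liveRepin₁₃_of_thm1Scaled F N (theta13OfNumerics F N n ε₂₉ (zeta316OfRecord F N n.ν n.τ9.M n.A₁) (RzOfRecord F N) (ZtOfRecord F N)) p (admissible_theta13OfNumerics F N _ _ _ hn hε')
    (hasResidualsOfRecord_theta13OfNumerics F N n ε₂₉) hκ hE₀ hB₀ h15 ha₀ hnum hBα hloc h238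

/-- **The (R₁₃) law slot at `θ₁₃(n)` from def-P11's ROW-P11 supplier hypotheses** (law form). [cite: Balaban1988Convergent, p.244 (bookkeeping); Balaban1985Variational, Thm 1 (8)–(10) p.279; Balaban1989LargeFieldII, Thm 1 p.355 (not exercised)] -/
theorem laws₁₃_theta13LiveOfNumerics_of_thm1Scaled (hn : n.Pos) (hε' : 0 < ε₂₉) (hκ : 0 ≤ n.s2.lf.κ) (hE₀ : 0 ≤ n.s2.lf.E₀) (hB₀ : 0 ≤ n.s2.lf.B₀)
    {B₃ a₀ a₁ : ℝ} (h15 : VariationalThm1Scaled F N B₃ a₀ a₁) (ha₀ : n.ν.εreg ≤ a₀)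
    (hnum : ∀ (p : B12.RunParams) (m' : ℕ), m' ≤ p.K → Step.InInterval n.γ m' (gOfRecord₁₃ F N (theta13OfNumerics F N n ε₂₉ (zeta316OfRecord F N n.ν n.τ9.M n.A₁) (RzOfRecord F N) (ZtOfRecord F N)) p) → ∀ m, m ≤ m' →
      0 < n.s2.cR * epsOfRecord n.ν (gOfRecord₁₃ F N (theta13OfNumerics F N n ε₂₉ (zeta316OfRecord F N n.ν n.τ9.M n.A₁) (RzOfRecord F N) (ZtOfRecord F N)) p) m ∧ n.s2.cR * epsOfRecord n.ν (gOfRecord₁₃ F N (theta13OfNumerics F N n ε₂₉ (zeta316OfRecord F N n.ν n.τ9.M n.A₁) (RzOfRecord F N) (ZtOfRecord F N)) p) m ≤ a₁ ∧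
        B₃ * (n.s2.cR * epsOfRecord n.ν (gOfRecord₁₃ F N (theta13OfNumerics F N n ε₂₉ (zeta316OfRecord F N n.ν n.τ9.M n.A₁) (RzOfRecord F N) (ZtOfRecord F N)) p) m) ≤ n.ν.εreg)
    (hBα : ∀ (p : B12.RunParams) (m' : ℕ), m' ≤ p.K → Step.InInterval n.γ m' (gOfRecord₁₃ F N (theta13OfNumerics F N n ε₂₉ (zeta316OfRecord F N n.ν n.τ9.M n.A₁) (RzOfRecord F N) (ZtOfRecord F N)) p) → ∀ m, 1 ≤ m → m ≤ m' →
      B₃ * (n.s2.cR * epsOfRecord n.ν (gOfRecord₁₃ F N (theta13OfNumerics F N n ε₂₉ (zeta316OfRecord F N n.ν n.τ9.M n.A₁) (RzOfRecord F N) (ZtOfRecord F N)) p) m) ≤ (1 - n.s2.βc) * (lfOfRecord₁₂ F N (theta13OfNumerics F N n ε₂₉ (zeta316OfRecord F N n.ν n.τ9.M n.A₁) (RzOfRecord F N) (ZtOfRecord F N)).toStage12Params).alpha0 ((gOfRecord₁₃ F N (theta13OfNumerics F N n ε₂₉ (zeta316OfRecord F N n.ν n.τ9.M n.A₁) (RzOfRecord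 F N) (ZtOfRecord F N)) p) m))
    (hloc : ∀ (p : B12.RunParams) (m' : ℕ), m' ≤ p.K → Step.InInterval n.γ m' (gOfRecord₁₃ F N (theta13OfNumerics F N n ε₂₉ (zeta316OfRecord F N n.ν n.τ9.M n.A₁) (RzOfRecord F N) (ZtOfRecord F N)) p) →
      ∀ (s : SeqOfRecord F n.ν n.τ9.M (gOfRecord₁₃ F N (theta13OfNumerics F N n ε₂₉ (zeta316OfRecord F N n.ν n.τ9.M n.A₁) (RzOfRecord F N) (ZtOfRecord F N)) p) p.K m') (W : MSField (F.P p.K) (SU N)), W ∈ suppOfRecord₁₃ F N (theta13OfNumerics F N n ε₂₉ (zeta316OfRecord F N n.ν n.τ9.M n.A₁) (RzOfRecord F N) (ZtOfRecord F N)) p m' s →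
      W ∈ solvableDom (avOfRecord F N p.K) (regMSOfRecord F N n.ν p.K m' s.Ω) (genSet s.Ω m') →
      ∀ j, 1 ≤ j → j ≤ m' → ∀ X : (Sect2.domSys (F.P p.K) n.τ9.M j).Dom, Sect2.domSites (F.P p.K) n.τ9.M j X ⊆ s.Λ j →
      ∀ C ∈ Sect2.cubesI n.τ9.M j (Sect2.domSites (F.P p.K) n.τ9.M j X), ∃ u : Site (F.P p.K) 0 → (MatA N)ˣ,
        (∀ x, u x ∈ (B12RegularSpaces111SpecialUnitary.suModel N).G) ∧ ∃ A : PBond (F.P p.K) 0 → MatA N,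
        (∀ bd ∈ C.bonds, gaugeU u (fun b' => ιSU N (UbgMSOfRecord F N n.ν n.τ9.M (gOfRecord₁₃ F N (theta13OfNumerics F N n ε₂₉ (zeta316OfRecord F N n.ν n.τ9.M n.A₁) (RzOfRecord F N) (ZtOfRecord F N)) p) p.K m' s W b')) bd = expI ((F.P p.K).eta j) (A bd)) ∧
        (∀ bd ∈ C.bonds, ‖A bd‖ < n.s2.cB * (lfOfRecord₁₂ F N (theta13OfNumerics F N n ε₂₉ (zeta316OfRecord F N n.ν n.τ9.M n.A₁) (RzOfRecord F N) (ZtOfRecord F N)).toStage12Params).alpha0 ((gOfRecord₁₃ F N (theta13OfNumerics F N n ε₂₉ (zeta316OfRecord F N n.ν n.τ9.M n.A₁) (RzOfRecord F N) (ZtOfRecord F N)) p) j)) ∧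
        ∀ q ∈ C.dpairs, ‖grad ((F.P p.K).eta j) q.2.1 (fun y => A ⟨y, q.2.2⟩) q.1‖ < n.s2.cB * (lfOfRecord₁₂ F N (theta13OfNumerics F N n ε₂₉ (zeta316OfRecord F N n.ν n.τ9.M n.A₁) (RzOfRecord F N) (ZtOfRecord F N)).toStage12Params).alpha0 ((gOfRecord₁₃ F N (theta13OfNumerics F N n ε₂₉ (zeta316OfRecord F N n.ν n.τ9.M n.A₁) (RzOfRecord F N) (ZtOfRecord F N)) p) j))
    (h238 : ∀ (p : B12.RunParams) (m' : ℕ), m' ≤ p.K → Step.InInterval n.γ m' (gOfRecord₁₃ F N (theta13OfNumerics F N n ε₂₉ (zeta316OfRecord F N n.ν n.τ9.M n.A₁) (RzOfRecord F N) (ZtOfRecord F N)) p) →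
      ∀ (s : SeqOfRecord F n.ν n.τ9.M (gOfRecord₁₃ F N (theta13OfNumerics F N n ε₂₉ (zeta316OfRecord F N n.ν n.τ9.M n.A₁) (RzOfRecord F N) (ZtOfRecord F N)) p) p.K m') (W : MSField (F.P p.K) (SU N)), W ∈ suppOfRecord₁₃ F N (theta13OfNumerics F N n ε₂₉ (zeta316OfRecord F N n.ν n.τ9.M n.A₁) (RzOfRecord F N) (ZtOfRecord F N)) p m' s →
      W ∈ solvableDom (avOfRecord F N p.K) (regMSOfRecord F N n.ν p.K m' s.Ω) (genSet s.Ω m') →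
      ∀ j, 1 ≤ j → j ≤ m' → ∀ X : (Sect2.domSys (F.P p.K) n.τ9.M j).Dom,
      Sect2.admB (F.P p.K) n.ν n.τ9.M (gOfRecord₁₃ F N (theta13OfNumerics F N n ε₂₉ (zeta316OfRecord F N n.ν n.τ9.M n.A₁) (RzOfRecord F N) (ZtOfRecord F N)) p) s.Ω s.Λ j (Sect2.domSites (F.P p.K) n.τ9.M j X) = true →
      CondII238 (B12RegularSpaces111SpecialUnitary.suModel N) (Sect2.frameMS (Sect2.Residual.unit (F.P p.K) (MatA N)) n.τ9.M j (Sect2.domSites (F.P p.K) n.τ9.M j X) s.Ω)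
        (MSConsts.ofParams (F.P p.K) n.s2.βc n.s2.B n.s2.C n.s2.Mr j) (fun m => (lfOfRecord₁₂ F N (theta13OfNumerics F N n ε₂₉ (zeta316OfRecord F N n.ν n.τ9.M n.A₁) (RzOfRecord F N) (ZtOfRecord F N)).toStage12Params).alpha0 ((gOfRecord₁₃ F N (theta13OfNumerics F N n ε₂₉ (zeta316OfRecord F N n.ν n.τ9.M n.A₁) (RzOfRecord F N) (ZtOfRecord F N)) p) m))
        (fun b' => ιSU N (UbgMSOfRecord F N n.ν n.τ9.M (gOfRecord₁₃ F N (theta13OfNumerics F N n ε₂₉ (zeta316OfRecord F N n.ν n.τ9.M n.A₁) (RzOfRecord F N) (ZtOfRecord F N)) p) p.K m' s W b'))) :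
    ∀ k, k < p.K → TLaw₁₃ F N (theta13LiveOfNumerics F N n ε₂₉ (zeta316OfRecord F N n.ν n.τ9.M n.A₁) (RzOfRecord F N) (ZtOfRecord F N)) p k → SLaw₁₃ F N (theta13LiveOfNumerics F N n ε₂₉ (zeta316OfRecord F N n.ν n.τ9.M n.A₁) (RzOfRecord F N) (ZtOfRecord F N)) p (k + 1) :=
  (rOpLeaf_VOfRecord₁₃_iff F N _ p).mp
    (rOpLeaf_VOfRecord₁₃_theta13LiveOfNumerics_of_thm1Scaled F N p hn hε' hκ hE₀ hB₀ h15 ha₀ hnum hBα hloc h238)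

end ThreeDesksNumerics

end Literature.MathematicalPhysics.QuantumFieldTheory.Balaban1983to89.B16RLeafRecord13AtLive

end
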